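import Mathlib
import HarnessLib
import HarnessLib.Audit
import Summits.Langlands.Statement
import Literature.NumberTheory.Automorphic.CompletedCohomology
import Literature.NumberTheory.Automorphic.Eigenvariety
import Literature.NumberTheory.Automorphic.TunnellOctahedralGlobal
import Literature.NumberTheory.Automorphic.BaseChangeUnramifiedLift
import HarnessLib.Audit.Status.Attr

/-!
Route: ParityBlindBianchi

DORMANT since 2026-08-24T16:49:27Z (reconciler: no traction for 6.9 d (last activity item-evidence-added at 2026-08-17T18:24:21Z); parked, not closed — `ledger route dormant route-Langlands-ParityBlindBianchi --off` to reactivate) — unstaffed, not closed; items shared with open routes are served there. `ledger route dormant <id> --off` reactivates.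

# Route ParityBlindBianchi — even icosahedral rho at the parity-blind prime 2 through Bianchi
completed cohomology of 2-split imaginary quadratic fields

It suffices to show X = E2′ ∧ R″ at the prime 2 over imaginary quadratic fields K in which 2 splits,
AT A PINNED TAME LEVEL. E2′ (TwoAdicBianchiProModularityLevel): an irreducible Artin representation
σ : Γ_K → GL₂(ℚ̄₂) of icosahedral type which is residually automorphic over K in COHOMOLOGICAL
weight off a finite set of rational primes S₀ ∋ 2 (some regular algebraic cuspidal π₀ of GL₂(𝔸_K)
has, at EVERY place v over no prime of S₀, Satake parameters whose HLTT arithmetic-Frobenius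
polynomial is congruent coefficientwise, in the maximal ideal of ℤ̄₂, to charpoly σ(Frob_v)) is
2-adically automorphic of tame level S₀: a continuous ℤ̄₂-point of the big Hecke algebra 𝕋(U^2) of
Emerton's completed cohomology of the 2-power Bianchi tower, U hyperspecial off S₀,
Hansen-associated with σ at every place off S₀ (torsion allowed; the occurrence predicate of
RuelleTorsionArtinWeight.ArtinPointsBianchi at p = 2 with the level pinned). R″
(ArtinWeightRealisationEven): when σ is the 2-adic model of ρ|_K for an EVEN icosahedral ρ over ℚ
and 0 ∉ S₀, such a point is Satake–Frobenius compatible with a cuspidal π_K of GL₂(𝔸_K) at EVERY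
place off S₀ (the even sector of the former route-local crux R′ ArtinWeightRealisationLevel; weight
0 at the complex place). For an even icosahedral ρ the residual input is FREE and UNIFORM in K (E1″
ResidualBianchiDoorLevelBC: ρ̄₂ is odd because −1 = +1, hence modular by Khare–Wintenberger–Kisin;
S₀ = {2} ∪ {primes of the level of the KW newform f and of the conductor of ρ} is chosen BEFORE K,
and BC_K(π_f) is the required π₀ for every 2-split K), and UNIFORM quadratic descent over all
2-split K (D″ IcosahedralDescentLevelBC: exceptional places confined over S₀) returns π(ρ) over ℚ —
the even icosahedral sector of (B), target EvenIcosahedralStrongArtin, junction EvenArtinJunction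
(both shared verbatim with route EvenArtinGL4Door). E1″/D″ are theorems in print stated
CONDITIONALLY on the promoted cruxes QuadraticBaseChangeGL2 / QuadraticDescentGL2 (Langlands 1980,
Arthur–Clozel III.4.2/5.1: the tree's XL-apex base-change/descent facts may not be cited in
closes-serving proofs, rulings rchoice-a6bd8d4f/bc22de8d). Realises card bianchi-artin-points (which
absorbed parity-blind-prime-two-even-artin): its receptacle O_K/R_K at p = 2. REV 8 (2026-08-16)
pinned the tame level (the a.e.-typed chain of revs 1–7 lost the level and made the descent
unprovable, see rationale NUMBERS). REV 17 (2026-08-17, route-choice on the negative-lemma hold of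
R′ stmt-Langlands-15111): the deciding theorem no longer consumes R′, whose junk zero sector 0 ∈ S₀
(no good place, empty Hecke family) forces the bare existence of Bianchi cusp forms
(Theorems/ArtinWeightRealisationLevel/Negative/ZeroSector.lean), nor E1′/D′ (no 0 ∉ S₀; D′
misstated): it runs over R″ and the base-change-conditional E1″/D″; R′, E1′, D′ stay in the file as
vestigial supports (dozens of landed Theorems name them).
Lean: `TwoAdicBianchiProModularityLevel ∧ ArtinWeightRealisationEven`

## Assembly
Pure logic (glue.lean = the deciding theorem `closes`, lean check rc 0, axioms propext,
Classical.choice, Quot.sound; gate audit ok, binders = the seven cruxes): an abstract field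
isomorphism ι : ℚ̄₂ ≃+* ℂ exists (both fields algebraically closed of characteristic 0 and
cardinality 𝔠; Steinitz, proved inline from Mathlib); EvenArtinJunction reduces the summit to the
target; given ρ irreducible icosahedral and EVEN (evenness is now consumed, by R″),
ResidualBianchiDoorLevelBC fed with QuadraticBaseChangeGL2 yields the uniform bad set S₀ (2 ∈ S₀, 0
∉ S₀) and, for every 2-split imaginary quadratic K, the 2-adic model σ of ρ|_K (finite image,
irreducible, projective image A₅) with a regular algebraic cuspidal π₀ congruent to σ at every place
off S₀; TwoAdicBianchiProModularityLevel turns this into a 2-adic Hecke point of tame level S₀;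
ArtinWeightRealisationEven (instantiated at p = 2, with ρ, the model relation and 0 ∉ S₀) gives a
cuspidal π_K compatible with σ at every place off S₀; IcosahedralDescentLevelBC, fed with
QuadraticDescentGL2, QuadraticBaseChangeGL2, S₀ and these (σ, π_K) for all K, returns the target for
ρ. closes : QuadraticDescentGL2 → QuadraticBaseChangeGL2 → ResidualBianchiDoorLevelBC →
TwoAdicBianchiProModularityLevel → ArtinWeightRealisationEven → IcosahedralDescentLevelBC →
EvenArtinJunction → Langlands has exactly the seven cruxes as hypotheses (the four base-change items
are in-print formalisation debt; the open cone is E2′ + R″ + the junction); the documentary Assembly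
item is the same implication and is proved by `closes`
(Theorems/ParityBlindBianchiAssemblyRev8.lean: `unfold Assembly; exact closes`).

Rationale: WHY THIS LINE. Over ℚ every lifting approach to an even ρ dies at step zero (mod p modular
representations are odd) and every p-adic receptacle is parity-locked (det ρ(c) is locally constant
on Spec 𝕋); at p = 2 oddness is vacuous, so ρ̄₂ (projective image A₅ ≅ SL₂(𝔽₄)) IS modular
[KhareWintenberger2009, KhareWintenberger2009II, Kisin2009TwoAdic], and over an imaginary quadratic
K there is no complex conjugation at all, so ρ|_{Γ_K} and the base change of the KW lift of ρ̄₂ live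
in ONE deformation problem whose expected dimension 1 + h¹ − h² = 1 + 1 + 8 − 4 = 6 equals the
Calegari–Emerton dimension 1 + dim B − l₀ = 1 + 6 − 1 of 𝕋(U^2) for Res_{K/ℚ}GL₂
[CalegariEmerton2011, GeeNewton2020]: occurrence of the Artin point is then exactly "big R = 𝕋 in
defect l₀ = 1" [CalegariGeraghty2017, GeeNewton2020, HansenUniversalEigenvarieties2017 Conj. 1.2.3],
torsion classes allowed and carrying determinants [Scholze2015, Thm V.4.1], with no residual
conjecture left to assume — whereas for odd p the residual input over K is Serre's conjecture over K
(numerics only: Figueiredo1999, Sengun2014Bianchi §11.1). Imported areas: p-adic automorphic forms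
(completed cohomology, defect-one patching), mod-2 Serre, solvable base change and descent
[LanglandsBaseChange1980, ArthurClozelAMS120, LabesseLanglands1979]; 2 split in K keeps the local
group GL₂(ℚ₂), where a p-adic local correspondence exists. Since rev 8 the chain is typed AT A
PINNED TAME LEVEL: a finite set S₀ ∋ 2 is fixed from ρ alone (2, the conductor of ρ, the level of
the KW form), every item demands or delivers compatibility at EVERY place of K over no element of
S₀, and the descent ℚ ← K is an honest theorem (exceptional places confined over S₀ uniformly in K).
Since rev 17 the deciding theorem consumes the EVEN-SECTOR realisation R″ (0 ∉ S₀, σ the ι-model of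
ρ|_K, ρ even) instead of R′, whose zero sector was junk (disprover, Negative/ZeroSector: 0 ∈ S₀
leaves no good place, the empty Hecke family always has a point, so R′ ⊢ bare existence of Bianchi
cusp forms from (K, ι, σ) alone), and the residual door / descent in their base-change-conditional
forms E1″/D″ over the promoted in-print cruxes (eight route-choice rulings 2026-08-16/17 concur;
this rev applies them). What it does that prior routes do not: the retired BianchiArtinPoints typed
occurrence through characteristic-0 approximants (obstructed by CalegariMazur2008 Cor. 1.4) and
ended at StrongArtinEvenQ; RuelleTorsionArtinWeight attacks occurrence for ALL Artin σ by a
torsion-growth law; EvenArtinGL4Door runs the same prime 2 through GL₄/ℚ (induction to kill parity,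
polarisation bookkeeping); here the receptacle is GL₂/K itself, the residual rung is a theorem, and
the single new load-bearing crux is the defect-one R = 𝕋 consequence at p = 2; negatives index
untouched.

RANKED CRUXES. #0 EvenIcosahedralStrongArtin (target; shared verbatim with EvenArtinGL4Door) — every
irreducible even ρ : Γ_ℚ → GL₂(ℂ) of icosahedral type has a cuspidal π on GL₂(𝔸_ℚ) whose Satake
parameters are the arithmetic-Frobenius eigenvalues of ρ a.e. (Tunnell's sense). (why it might fail:
false only if (B) fails for an even icosahedral ρ/ℚ; no example is known automorphic, Calegari2023
§12.) [Calegari2023, BuzzardGeeLMS2014, DoudMoore2006, KhareWintenberger2009]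
#2 TwoAdicBianchiProModularityLevel (crux, E2′) — K imaginary quadratic with 2 split, ι : ℚ̄₂ ≃ ℂ, σ
: Γ_K → GL₂(ℚ̄₂) continuous with finite image, irreducible, projective image ≅ A₅; S₀ ∋ 2 a finite
set of naturals (good places = places of K over no element of S₀). If some regular algebraic
cuspidal π₀ of GL₂(𝔸_K) has at EVERY good v a Satake parameter α with arithFrobPolyOfSatake ι q_v 2
α ≡ charpoly σ(Frob_v) coefficientwise in the maximal ideal of ℤ̄₂ (σ unramified at v), then σ is
2-adically automorphic of tame level S₀: U hyperspecial at every good place (free over S₀),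
uniformisers and ℤ̄₂-valued eigenvalues a_{v,i} at the good places forming a continuous point of Spf
𝕋(U^2) of the 2-power Bianchi tower (IsHeckePoint, torsion allowed) Hansen-associated with σ at
every good v (IsHeckeAssociatedAt). Informal content: R_{S₀}(σ̄) = 𝕋(U^2)_𝔪 for GL₂/K in defect l₀ =
1 at p = 2, read at the Artin point; larger S₀ is weaker, so no Ihara/level-raising input is hidden;
its zero sector is free (Disproof §a1: E2′ ↔ E2′ with 0 ∉ S₀). [difficulty: open-problem] (why it
might fail: defect-one big R=𝕋 is conditional even for p odd (GeeNewton2020: codimension conjecture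
+ torsion LGC at p); p = 2 adds non-adequate image SL₂(𝔽₄), Kisin-type 2-adic local rings and wild
level; torsion LGC over imaginary quadratic F at p = 2 is in no paper; association at every good
place.) [CalegariGeraghty2017, GeeNewton2020, HansenUniversalEigenvarieties2017,
CalegariEmerton2011, Scholze2015, CaraianiNewton2023, Kisin2009TwoAdic,
AllenKhareThorne2021WeightOne]
#3 ArtinWeightRealisationEven (crux, R″; in closes since rev 17) — p prime, ι : ℚ̄_p ≃ ℂ; ρ : Γ_ℚ →
GL₂(ℂ) irreducible, projective image A₅, EVEN; K imaginary quadratic; σ : Γ_K → GL₂(ℚ̄_p) the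
entrywise ι-model of ρ|_K, finite image, irreducible; S₀ with p ∈ S₀, 0 ∉ S₀. If σ is p-adically
automorphic of tame level S₀ (E2′'s conclusion package verbatim with 2 ↦ p) then some cuspidal π of
GL₂(𝔸_K) has SatakeFrobCompatibleAt ι π σ w at EVERY good w (Artin type, weight 0 at the complex
place). Kernel-checked frame: R′ → R″ (pure specialisation, Theorems/…EvenOfLevel); R → JL → R″
(p121004: the shared a.e. crux RuelleTorsionArtinWeight.ArtinWeightRealisation stmt-11057 + the
named fact JacquetLanglands1970_twistedHeckeTheoryGL2); Target → AC 4.2(a) → JL → R″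
(EvenCoreOfTarget p125574) and E1′ → E2′ → R″-instance → D′ → Target (RouteSector p125161): modulo
theorems in print and the other items R″ is EQUIVALENT to the target, and it contains no in-print
sector (solvable images excluded, odd restrictions excluded by evenness, zero sector excluded by 0 ∉
S₀). Its only edge over the target is the p-adic automorphy hypothesis: the honest open bet is
singular-weight classicality over a field with a complex place. Used at p = 2. [deps:
TwoAdicBianchiProModularityLevel] [difficulty: open-problem] (why it might fail: the
non-regular-weight wall over a field with a complex place: no Shimura variety, no
q-expansion/companion-form gluing (BuzzardTaylor1999 is ℚ-only), no p-adic LGC at singular weight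
(AllenKhareThorne2021WeightOne §1); every good place demanded; for even ρ no base-change shortcut.)
[AllenKhareThorne2021WeightOne, Scholze2015, Calegari2023, HansenUniversalEigenvarieties2017,
BuzzardTaylor1999, CalegariMazur2008, Literature.Barriers.Langlands.NonRegularWeightBarrier]
#4 QuadraticDescentGL2 (crux, promoted rev 10) — E/F quadratic, P cuspidal on GL₂(𝔸_E) with
Gal(E/F)-stable Satake data a.e. ⇒ P is a weak base-change lift of a cuspidal π on GL₂(𝔸_F);
verbatim the n = 2 case of the tree fact cuspidal_descent_cyclic (ruled XL-apex: twisted trace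
formula, no L-function proof). [difficulty: XL, theorem in print] (why it might fail: only by drift
of the Borel–Jacquet data — free |det|^s twist, a.e. Satake shadow of P ≅ P∘σ.)
[LanglandsBaseChange1980, ArthurClozelAMS120 Ch. 3 Thm 4.2 (d), Gelbart1997 Thm 6.1 (c),
JacquetShalikaAJM1981II]
#5 QuadraticBaseChangeGL2 (crux, promoted rev 10) — four clauses, the n = 2 cases of
baseChange_cyclic_cuspidal (cuspidal weak lift given a Satake parameter α ≠ −α at one inert place),
ArthurClozel1989_strongLifting_unramified, …_allFinite (t_{P,w} = t_{π,v}^{f} at every finite w,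
ramified v allowed), …_archimedean. [difficulty: XL, theorem in print] (why it might fail: only
drift: the inert witness must force π ≇ π ⊗ η (it does); strong lifting asserted for any cuspidal
weak lift (= BC(π) by SMO).) [LanglandsBaseChange1980, ArthurClozelAMS120 Ch. 3 Thm 4.2 (a), 5.1,
Jacquet1972, Gelbart1997 §6]
#6 ResidualBianchiDoorLevelBC (crux, E1″) — QuadraticBaseChangeGL2 → E1′R: for ρ irreducible
icosahedral over ℚ and ι : ℚ̄₂ ≃ ℂ there is S₀ with 2 ∈ S₀, 0 ∉ S₀ (from ρ alone) such that for
every 2-split imaginary quadratic K the entrywise ι-model σ of ρ|_K is a finite-image irreducible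
Γ_K → GL₂(ℚ̄₂) with projective image A₅ and some regular algebraic cuspidal π₀ (= BC_K(π_f), f the
KW newform of ρ̄₂, odd for free) is congruent to σ at EVERY good place. PROVABLE NOW modulo the
cited fact khare_wintenberger 2 (facts ⊢ E1′R kernel-checked, p125055; re-plumb over clauses
(a),(c),(d)). [difficulty: M, mechanical] (why it might fail: cannot fail mathematically; only if a
use site of the full base-change facts in p125055 is not at n = 2 — checked.)
[KhareWintenberger2009, Kisin2009TwoAdic, ArthurClozelAMS120, LanglandsBaseChange1980, Deligne1971,
HarrisLanTaylorThorneRMS2016]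
#7 IcosahedralDescentLevelBC (crux, D″) — QuadraticDescentGL2 → QuadraticBaseChangeGL2 → D′R: if ONE
finite S₀ with 0 ∉ S₀ serves every 2-split imaginary quadratic K (a 2-adic model σ of ρ|_K and a
cuspidal π_K with SatakeFrobCompatibleAt ι π_K σ w at every good w), then some cuspidal π of
GL₂(𝔸_ℚ) matches ρ a.e. (anchor descent from K₁, K₁K₂ alignment — A₅ has no dihedral quotient —,
exact split read-off at the good places, contragredient). PROVABLE NOW modulo the tree-decomposed
cited fact ArthurClozel_fibres_quadratic (F1–F4 ⊢ D′R kernel-checked, p111861/p125164). [difficulty: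
M, mechanical] (why it might fail: cannot fail mathematically; provable only because S₀ is uniform
in K and 0 ∉ S₀; drift of the m = 1 arithmetic dictionary.) [LanglandsBaseChange1980,
ArthurClozelAMS120 Ch. 3, LabesseLanglands1979, Ramakrishnan1994, Tunnell1981, Gelbart1997]
#9 EvenArtinJunction (crux by the crux-only rule; shared verbatim with EvenArtinGL4Door) X →
Langlands: the rest of the summit (regular / totally-real–CM sectors, other n and F, direction (A),
and the upgrade of the a.e. matching to `Corresponds` at every finite place) — listed so that closes
ends in the summit constant. [difficulty: open-problem] [BuzzardGeeLMS2014,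
FontaineMazurGeometric1995]
SUPPORTS, NOT IN closes (vestigial since rev 17; kept as decls because 45 / 13 / 25 landed Theorems,
Negative and Cruxes files name them — a later drop belongs in an operator maintenance window
together with the dependency-drift repair): R′ ArtinWeightRealisationLevel (stmt-15111, HELD: all
finite-image irreducible σ over K; R′ → R″; closed modulo item 11057 + JL, p102944/p121004; zero
sector junk, p ∈ S₀ idle — Negative/ZeroSector, PlacesOverP; 32 leads ended blocked-on 11057; its
genuine-icosahedral sector G has no host and is parked with 11057 —
Cruxes/ArtinWeightRealisationLevel/STRATEGY-CENSUS.md, SPLIT.md); E1′ ResidualBianchiDoorLevel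
(stmt-15112: ⟸ E1′R; without 0 ∉ S₀ witnessed by S₀ = {0, 2}, loophole); D′ IcosahedralDescentLevel
(stmt-15113: MISSTATED — S₀ = {0} leaves no good place, so D′ ≡ all-parity icosahedral strong Artin
≡ GaloisWeightedBE.StrongArtinIcosahedralQ, p116764 — do not attempt); E1′R
ResidualBianchiDoorLevelR (stmt-16621) and D′R IcosahedralDescentLevelR (stmt-16620), the conclusion
texts E1″/D″ unfold to (proved modulo cited facts, p125055 / p111861). RETIRED AT REV 8: the
a.e.-typed E1/E2/R/D of revs 1–7 and the glue EvenIcosahedralFromBianchi (proved inline); dropped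
earlier: the two dihedral occurrence probes (special cases of
RuelleTorsionArtinWeight.ArtinPointsBianchi).

TWO-LAYER PLAN. TwoAdicBianchiProModularityLevel ⇐ BigRT2Bianchi (the surjection R_{S₀}(σ̄) →
𝕋(U^2)_𝔪 is an isomorphism for σ̄ : Γ_K → GL₂(𝔽̄₂) with projective image A₅, 2 split in K, U
hyperspecial off S₀: Calegari–Geraghty / Gee–Newton patching of completed homology in defect one at
p = 2; needs the deformation-ring definition request) → ArtinLiftIsHeckePoint (a ℤ̄₂-point of R =
𝕋_𝔪 with finite image is a continuous point of Spf 𝕋(U^2) Hansen-associated with σ at every good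
place: bookkeeping) → TwoAdicBianchiProModularityLevel (k = 2). Calibration child foreseen, not
filed: the same conclusion for σ = base change of an ODD icosahedral ρ′ (through the 2-adic
eigencurve over ℚ). Deliberately NOT a child: the characteristic-0 shadow "ρ|_K is a 2-adic limit of
regular algebraic cuspidal π_m of fixed tame level" — expected FALSE off CM/base-change components
(CalegariMazur2008 Thm 1.1, Cor. 1.4), which is why occurrence is typed with torsion allowed.
ArtinWeightRealisationEven ⇐ (the locally analytic σ-eigenspace of completed cohomology at tame
level S₀ has the singular infinitesimal character) → (singular-weight classicality over K at level
U, yielding compatibility at every good place); admissible engines recorded by the crux chain on R′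
(TRIAGE-r2-1/2/3, STRATEGY-CENSUS §4: the U(2,2) Siegel–Eisenstein/CAP wall at scalar weight 2, a
weight-two Eisenstein host, the mod-two Maass-lift seed) — all unprinted; split in one place
together with RuelleTorsionArtinWeight's R once E2′ or item 11057 moves.

KILL CRITERIA. TwoAdicBianchiProModularityLevel refuted for one admissible (K, σ, S₀) — e.g. a proof
that some icosahedral Artin lift of a cohomologically modular σ̄ is isolated from Spf 𝕋(U^2) at its
own tame level, or the Cheapest-falsifier computation returning "present mod 2, absent mod 4 at
every accessible 2-power level" for the base change of an even icosahedral ρ — closes the route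
`refuted:TwoAdicBianchiProModularityLevel` (the parity-blind receptacle is dead; EvenArtinGL4Door is
then the only p = 2 line). A theorem placing an AUTOMORPHIC Artin point over K — e.g. a theta series
AI_{L/K}(χ), read through RuelleTorsionArtinWeight.ArtinPointsBianchi — provably outside Spf 𝕋(U^p)
in the torsion sense refutes Fontaine–Mazur–Emerton occurrence over K and kills the mechanism of E2′
with every completed-cohomology receptacle over K: the planner then closes the route
(refuted:TwoAdicBianchiProModularityLevel once the isolation argument is run at an A₅ point, else
exhausted with that census). ArtinWeightRealisationEven is shared fate with the Artin-over-CM wall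
(no pivot); being target-equivalent modulo print it can be refuted only together with even
icosahedral strong Artin; its junk sectors are typed away (0 ∉ S₀; p ∈ S₀ idle). A refutation of
QuadraticDescentGL2, QuadraticBaseChangeGL2, E1″ or D″ can only be vocabulary drift (theorems in
print; E1′R/D′R kernel-checked from the facts): repair by restate, never a pivot. Target proved
elsewhere (EvenArtinGL4Door, EvenArtinQuantumBoundary, GaloisWeightedBE) moots the route; E2′ + R″
then remain GL₂/K statements of independent interest.

NOT DECOMPOSED YET. The R = 𝕋 statement itself (needs universal deformation rings of ρ̄ : Γ_K →
GL₂(𝔽̄₂) unramified outside S₀ with fixed type over S₀ — definition request below) and its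
Taylor–Wiles/Calegari–Geraghty inputs at p = 2 (adequacy substitute for SL₂(𝔽₄), local lifting rings
at v ∣ 2, torsion local–global compatibility for Bianchi classes at p = 2); the singular-weight
classicality engine behind R″ (no child filed); the genuine-icosahedral sector G of R′ (not this
route's business: parked with item 11057); the card's Smith-theoretic descent (TreumannVenkatesh2016
read downwards: unprinted — not an item); the odd-p analogue (residual input = Serre over K);
local–global compatibility at ramified places and IsLAlgebraic of π(ρ) (inside EvenArtinJunction); K
with 2 inert or ramified (not needed); the next promotion if the harness rules khare_wintenberger 2
apex as well (shared with EvenArtinGL4Door.ResidualDoorMod2); helper lemmas ride with the provers as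
`--supports`.

CHEAPEST FALSIFIER. Take the even icosahedral ρ of smallest conductor N in DoudMoore2006 and K =
ℚ(√−7) or ℚ(√−15) (2 split, disjoint from the A₅-field), f the weight-2 newform with ρ̄_f ≅ ρ̄₂
(level dividing 4N², computable from mod-2 data), S₀ = {2} ∪ primes(N) ∪ primes(level f), 𝔫 = level
of BC_K(f) times the conductor of ρ|_K. Compute the Hecke module H¹(Γ₀(𝔫·2^s) ≤ GL₂(O_K), ℤ/2^m)
(Şengün/Yasaki-type Bianchi modular-symbol code, s ≤ 2, m ≤ 3) and test for an eigensystem ≡ tr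
ρ|_K(Frob_w) mod 2^m at the first 30 split primes outside S₀. E2′ predicts PRESENCE at some (s, m ≥
2); presence mod 2 with absence mod 4 at all s ≤ 2 is strong evidence against E2′ (not a proof:
deeper s is allowed). Not run here (hub compute-free; Bianchi torsion code not on the kit farm).
Lookup falsifier: any theorem isolating Artin points of Spf 𝕋(U^p) over K off CM/base-change
components in the TORSION sense (CalegariMazur2008 is characteristic 0, nearly ordinary only) would
kill E2′ — none found.

NUMBERS. l₀(SL₂(ℂ)) = 1, q₀ = 1; dim B(ℚ₂) for Res_{K/ℚ}GL₂ with 2 split = 3 + 3 = 6, so the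
Calegari–Emerton dimension of 𝕋(U^2)_𝔪 is 1 + 6 − 1 = 6, matching 1 + h¹ − h² = 1 + h⁰ − χ(ad) = 1 +
1 − (4 − 8) = 6 for unrestricted deformations of an absolutely irreducible ρ̄ : Γ_K → GL₂ (one
complex place: Σ_{v∣∞} h⁰(G_v, ad) = 4): numerology consistent, no parity term (over ℚ at p = 2 the
same count splits R^univ into even and odd parts and only the odd one is 𝕋). Projective image of ρ̄₂
and of ρ̄₂|_K is A₅ (a normal 2-subgroup of A₅ is trivial; A₅ has no subgroup of index 2). WHY THE
OLD DESCENT D WAS UNPROVABLE (rev-8 analysis): with a K-dependent exceptional set E_K, aligning the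
descents from K₁, K₂, … yields one cuspidal π on GL₂(𝔸_ℚ) with BC_K(π) ≅ π_K for all K and
Satake(π_p) = ±ρ^∨(Frob_p), the sign certified + only at primes split in some K with p ∉ E_K;
infinitely many fields are needed (the primes inert in K₁, …, K_m have density 2^{−m}) and ⋃_K E_K
is uncontrolled, so an infinite, arbitrarily sparse sign-defect set B is consistent with every
hypothesis; conversely any π′ matching ρ a.e. has contragredient agreeing with π off the density-0
set B, hence ≅ π by Ramakrishnan1994, so D ⟺ "B finite" — Artin-hard and in no paper; only a UNIFORM
bad set repairs it, whence S₀, and 0 ∉ S₀ keeps the good places non-empty. Items after rev 17: 14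
active — cruxes E2′ r2, R″ r3, QuadraticDescentGL2 r4, QuadraticBaseChangeGL2 r5, E1″ r6, D″ r7, J
r9; target; Assembly (restated at rev 17 to the seven-crux chain, proved verbatim by
Theorems/ParityBlindBianchiAssemblyRev8.lean `unfold Assembly; exact closes`); supports R′, E1′, D′
(vestigial), E1′R, D′R (texts). closes has exactly the seven cruxes as hypotheses (cone 7/7: four
in-print base-change items + E2′ + R″ + junction). History: 9 items at open (2026-08-15); 8 after
the 2026-08-16 morning repairs; 7 at rev 8 (level control); rev 10/14 added R″, the promoted base
change/descent and the BC-conditional door/descent; rev 17 re-glued closes over them.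

DEFINITION REQUESTS. D1 (for the layer-2 child BigRT2Bianchi, to be filed by tenure when
TwoAdicBianchiProModularityLevel is split; no item needs it now): universal deformation ring of an
absolutely irreducible ρ̄ : Γ_K → GL₂(k), k finite, unramified outside the places over S₀ with fixed
type there, and its map to 𝕋(U^p)_𝔪 from Scholze determinants — topic
Literature/NumberTheory/GaloisRepresentations. Cite-facts used as hypotheses of the provers'
theorems for E1″/D″ (never of closes): Khare–Wintenberger mod 2 (tree khare_wintenberger /
exists_newform_of_odd_irreducible), ArthurClozel_fibres_quadratic (tree-decomposed, Jacquet–Shalika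
+ multiplicity one), Galois representations of newforms (Deligne1971), contragredient (tree
exists_contragredient_satake), Scholze2015 Thm V.4.1 for Bianchi torsion (E2′ children).

Novelty: Searches (2026-08-15; lit searchd and galaxy unreachable from this seat all session (rc 75), so the
literature searches are those recorded on the two merged cards and on the gen-1 route, plus this
session's reading of the tree): card audits aud-17/19/20 (arXiv:1412.1533 Hansen Conj. 1.2.3;
arXiv:0708.2451 = CalegariMazur2008; doi:10.4007/annals.2016.183.1.4 and arXiv:2009.14236 Smith
theory; Figueiredo1999; Sengun2014Bianchi §11.1); parity-blind card: arXiv:2109.14145 (Calegari2023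
§12 "no progress"); this session: full read of Theses/RuelleTorsionArtinWeight.lean,
EvenArtinGL4Door.lean, BianchiArtinPoints.lean (closed) and of the cards
even-icosahedral-p3-cm-corner, kw-ladder-gaussian-field, smith-ai-mod-p,
serre-count-census-imaginary-quadratic, thickened-residual-patching,
parity-blind-prime-two-even-artin; lean search over CompletedCohomology / Eigenvariety /
ReciprocityGLn.
Nearest prior art found: CalegariGeraghty2017 (defect-one modularity lifting for GL₂ over imaginary
quadratic fields, conditional, regular or weight-one-type targets) and GeeNewton2020 (big R = 𝕋 for
completed homology from the codimension conjecture); KhareWintenberger2009 + Kisin2009TwoAdic (ρ̄₂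
modular); on the hub EvenArtinGL4Door (same prime, GL₄/ℚ receptacle) and RuelleTorsionArtinWeight
(same receptacle, all σ, torsion-growth detector).
Delta: residual automorphy of an EVEN icosahedral ρ over K comes for free at p = 2 from ℚ, so the
even sector of (B) is reduced to one defect-one big R = 𝕋 cons  [refs: 10.4007/annals.2016.183.1.4, 1412.1533, 0708.2451, 2009.14236, 2109.14145, doi:10.4007/annals.2016.183.1.4, CalegariMazur2008, Figueiredo1999, Calegari2023, CalegariGeraghty2017, GeeNewton2020, KhareWintenberger2009]

Barriers (technique_class: completed-cohomology, two-adic-lifting, modularity-lifting): - technique_class: completed-cohomology, two-adic-lifting, modularity-lifting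
- Literature.Barriers.Langlands.NonRegularWeightBarrier: APPLIES verbatim to ArtinWeightRealisation
(weight (0,0) at the complex place; no classicality mechanism is claimed — the item IS the wall,
shared with RuelleTorsionArtinWeight); EVADED for occurrence: completed cohomology with torsion
coefficients needs no regular weight, and the residual rung uses the regular weight of BC_K(f).
- Literature.Barriers.Langlands.TaylorWilesNumericalCoincidence: it does not evade it; the bet is
Calegari–Geraghty/Gee–Newton patching of completed homology in defect l₀ = 1 (the numerology 6 = 6
above replaces the l₀ = 0 coincidence), at p = 2.
- Literature.Barriers.Langlands.TaylorWilesNumericalCoincidenceNarrow: same —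
TwoAdicBianchiProModularity is a positive-defect statement; no single-degree patching is proposed.
- Literature.Barriers.Langlands.PatchingLocalComponentBarrier: engaged at v ∣ 2 only; 2 split in K
makes K_v = ℚ₂, where GL₂(ℚ₂) has a p-adic local Langlands correspondence (Colmez; Paškūnas/CDP with
the p = 2 caveats) and Kisin's 2-adic local rings exist; the Artin point is unramified, potentially
crystalline of slope 0.
- Literature.Barriers.Langlands.ModPLanglandsGL2BeyondQp: evaded by design — every field in the
chain has 2 split (K_v = ℚ₂); no mod-p or p-adic correspondence for GL₂(F), F ≠ ℚ_p, is invoked.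
- Literature.Barriers.Langlands.ModPLanglandsGL2BeyondQpFpBar: same (2-split K only).
- Lite

History (route lifecycle, newest last):
- 2026-08-16T07:18:59Z · rev 7: dropped NonCMDihedralOccurrence, CMDihedralOccurrence — route-repair (unused-crux, rrepair-u-ab6ac341): DROP NonCMDihedralOccurrence (ex-crux r4, stmt-Langlands-13458) and the equally off-chain support CMDihedralOccu (planner-rrepair-Langlands-ParityBlindBianchi-u-ab6ac341-0)
- 2026-08-16T07:53:07Z · rev 8: restated Assembly (stmt-Langlands-13462 proved) — route-repair g2 (rbadge-b03b5347-g2), rev 8: CRUX-ONLY deciding theorem + LEVEL CONTROL. The gate stamp glue.non-crux-hypothesis named E1 ResidualBianchiDoorMod (planner-rbadge-Langlands-ParityBlindBianchi-b03b5347-g2-0)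
- 2026-08-16T07:53:07Z · rev 8: dropped ResidualBianchiDoorMod2, TwoAdicBianchiProModularity, ArtinWeightRealisation, IcosahedralQuadraticDescent, EvenIcosahedralFromBianchi — route-repair g2 (rbadge-b03b5347-g2), rev 8: CRUX-ONLY deciding theorem + LEVEL CONTROL. The gate stamp glue.non-crux-hypothesis named E1 ResidualBianchiDoorMod (planner-rbadge-Langlands-ParityBlindBianchi-b03b5347-g2-0)
- 2026-08-17T04:12:21Z · rev 18: restated Assembly (stmt-Langlands-15109 proved) — rev 17 (route-choice rchoice-Langlands-ParityBlindBianchi-A-303d852a, negative-lemma hold on R′ stmt-15111; applies the re-route certified by eight prior ruling (planner-rchoice-Langlands-ParityBlindBianchi-A-303d852a-0)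
- 2026-08-24T16:49:27Z · DORMANT — reconciler: no traction for 6.9 d (last activity item-evidence-added at 2026-08-17T18:24:21Z); parked, not closed — `ledger route dormant route-Langlands-Parity (operator:999:1082112)

sub-problem: Langlands · status: dormant · opened planner-plancard-Langlands-Langlands-bianchi--06629191-g2-0 2026-08-15T19:01:47Z · rev 18 · ledger route-Langlands-ParityBlindBianchi
GENERATED by the gate from the ledger (D-0016/17). Provers cite these decls: `theorem foo : Summit.Langlands.Langlands.Theses.ParityBlindBianchi.<Decl> := …` in Summits/Langlands/Langlands/Theorems/<Name>.lean.
-/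

namespace Summit.Langlands.Langlands.Theses.ParityBlindBianchi

open scoped BigOperators Topology Manifold Classical MeasureTheory ProbabilityTheory Matrix InnerProductSpace ComplexConjugate ContinuousMap
open Filter Set Function TopologicalSpace MeasureTheory

attribute [summit_statement] _root_.Langlands

/-- item stmt-Langlands-2903 · target · rank 0 · open · by planner
why it might fail: False only if reciprocity (B) fails for an even icosahedral ρ/ℚ; no such ρ is known automorphic, Maass forms of eigenvalue 1/4 are inaccessible (Calegari2023 §12: 'we cannot establish the Artin conjecture for a single [even SL₂(𝔽₅)] representation'); solvable = Langlands–Tunnell, odd A₅ = KW+Kisin.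
sources: Calegari2023 §12, BuzzardGeeLMS2014, DoudMoore2006, KhareWintenberger2009, Kisin2009TwoAdic
[target] strong Artin in Tunnell's a.e. sense for every irreducible even icosahedral ρ : Γ_ℚ →
GL₂(ℂ): ∃ cuspidal π on GL₂(𝔸_ℚ) with `IsPiOfArtinRep ρ π`. -/
@[route_item "route-Langlands-ParityBlindBianchi", crux]
def EvenIcosahedralStrongArtin : Prop :=
  ∀ ρ : Literature.NumberTheory.GaloisRepresentations.FramedGaloisRep ℚ ℂ 2, ρ.toGaloisRep.IsIrreducible → Nonempty ((Matrix.ProjGenLinGroup.mk.comp ρ.toMonoidHom).range ≃* alternatingGroup (Fin 5)) → (∀ (φ : ℚ →+* ℝ) (c : Field.absoluteGaloisGroup ℚ), Literature.NumberTheory.GaloisRepresentations.IsComplexConjugation φ c → Matrix.GeneralLinearGroup.det (ρ c) = 1) → ∃ (hcpt : Literature.NumberTheory.Automorphic.isCompact_glFiniteIntegralLevel 2 ℚ) (π : Literature.NumberTheory.Automorphic.CuspidalAutomorphicRepData 2 ℚ hcpt), (∀ᶠ v : IsDedekindDomain.HeightOneSpectrum (NumberField.RingOfIntegers ℚ) in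 Filter.cofinite, ∃ α : Multiset ℂ, π.1.HasSatakeParamAt v α ∧ ρ.IsUnramifiedAt v ∧ ρ.HasFrobCharpolyAt v (Literature.NumberTheory.Automorphic.satakePolynomial α))

/-- item stmt-Langlands-15110 · crux · rank 2 · open · by planner
why it might fail: Defect-one big R=𝕋 is conditional even for p odd (GeeNewton2020: codimension conj. + torsion LGC); p = 2 adds non-adequate image SL₂(𝔽₄), Kisin-type 2-adic local rings, wild level; torsion LGC over imaginary quadratic F at p = 2 is in no paper; level now pinned (association at every good place).
sources: GeeNewton2020 §3.1, Def. 17, Thm 2, Conj. 23/27, CalegariGeraghty2017 Thm 1.1, HansenUniversalEigenvarieties2017 Conj. 1.2.3, CalegariEmerton2011, Scholze2015 Thm V.4.1, CaraianiNewton2023 Thm 1.3, Rem. 1.3.1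
[crux] (E2′, rev 8: level pinned) K imaginary quadratic with 2 split, ι : ℚ̄₂ ≃ ℂ, σ : Γ_K →
GL₂(ℚ̄₂) continuous with finite image, irreducible, projective image ≅ A₅; S₀ a finite set of
rational primes with 2 ∈ S₀ (good places = places of K over no prime of S₀). If σ is residually
automorphic over K in cohomological weight off S₀ — some regular algebraic cuspidal π₀ of GL₂(𝔸_K)
has at EVERY good v a Satake parameter α with arithFrobPolyOfSatake ι q_v 2 α ≡ charpoly σ(Frob_v)
coefficientwise in the maximal ideal of ℤ̄₂ (σ unramified at v) — then σ is 2-adically automorphic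
of tame level S₀: there are U hyperspecial at every good place (free over S₀), uniformisers and
ℤ̄₂-valued eigenvalues a_{v,i} at the good places forming a continuous point of Spf 𝕋(U^2) of the
2-power Bianchi tower (IsHeckePoint, torsion allowed) Hansen-associated with σ at every good v
(IsHeckeAssociatedAt). Informal content: R_{S₀}(σ̄) = 𝕋(U^2)_𝔪 for GL₂/K in defect l₀ = 1 at p = 2,
read at the Artin point; larger S₀ is weaker (U free over S₀: no Ihara/level-raising input).
Supersedes TwoAdicBianchiProModularity (stmt-Langlands-13457: conclusion ∃ S, prover-chosen level).
[difficulty: open-problem] -/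
@[route_item "route-Langlands-ParityBlindBianchi", crux]
def TwoAdicBianchiProModularityLevel : Prop :=
  ∀ (K : Type) [Field K] [NumberField K], NumberField.IsTotallyComplex K → Module.finrank ℚ K = 2 → (∃ v w : IsDedekindDomain.HeightOneSpectrum (NumberField.RingOfIntegers K), v ≠ w ∧ ((2 : ℕ) : NumberField.RingOfIntegers K) ∈ v.asIdeal ∧ ((2 : ℕ) : NumberField.RingOfIntegers K) ∈ w.asIdeal) → ∀ (ι : PadicAlgCl 2 ≃+* ℂ) (σ : Literature.NumberTheory.GaloisRepresentations.FramedGaloisRep K (PadicAlgCl 2) 2), Finite σ.toMonoidHom.range → σ.toGaloisRep.IsIrreducible → Nonempty ((Matrix.ProjGenLinGroup.mk.comp σ.toMonoidHom).range ≃* alternatingGroup (Fin 5)) → ∀ S₀ : Finset ℕ, 2 ∈ S₀ → (∃ (hcpt : Literature.NumberTheory.Automorphic.isCompact_glFiniteIntegralLevel 2 K) (π₀ : Literature.NumberTheory.Automorphic.CuspidalAutomorphicRepData 2 K hcpt), π₀.1.IsRegularAlgebraic ∧ ∀ v : IsDedekindDomain.HeightOneSpectrum (NumberField.RingOfIntegers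 K), (∀ ℓ ∈ S₀, ((ℓ : ℕ) : NumberField.RingOfIntegers K) ∉ v.asIdeal) → ∃ (α : Multiset ℂ) (P : Polynomial (PadicAlgCl 2)), π₀.1.HasSatakeParamAt v α ∧ σ.IsUnramifiedAt v ∧ σ.HasFrobCharpolyAt v P ∧ ∀ i : ℕ, ‖P.coeff i - (Literature.NumberTheory.Automorphic.arithFrobPolyOfSatake ι v.residueCard 2 α).coeff i‖ < 1) → ∃ (U : Subgroup (GL (Fin 2) (IsDedekindDomain.FiniteAdeleRing (NumberField.RingOfIntegers K) K))) (ϖ : ∀ v : IsDedekindDomain.HeightOneSpectrum (NumberField.RingOfIntegers K), (v.adicCompletion K)ˣ) (a : {v : IsDedekindDomain.HeightOneSpectrum (NumberField.RingOfIntegers K) // ∀ ℓ ∈ S₀, ((ℓ : ℕ) : NumberField.RingOfIntegers K) ∉ v.asIdeal} → ℕ → (Valued.v (R := PadicAlgCl 2)).valuationSubring), IsOpen (U : Set (GL (Fin 2) (IsDedekindDomain.FiniteAdeleRing (NumberField.RingOfIntegers K) K))) ∧ U ≤ Literature.NumberTheory.Automorphic.glFiniteIntegralLevel 2 K ∧ (∀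 g ∈ Literature.NumberTheory.Automorphic.glFiniteIntegralLevel 2 K, (∀ v : IsDedekindDomain.HeightOneSpectrum (NumberField.RingOfIntegers K), ¬ (∀ ℓ ∈ S₀, ((ℓ : ℕ) : NumberField.RingOfIntegers K) ∉ v.asIdeal) → ∀ i j : Fin 2, ((g : Matrix (Fin 2) (Fin 2) (IsDedekindDomain.FiniteAdeleRing (NumberField.RingOfIntegers K) K)) i j) v = (1 : Matrix (Fin 2) (Fin 2) (v.adicCompletion K)) i j) → g ∈ U) ∧ (∀ v : IsDedekindDomain.HeightOneSpectrum (NumberField.RingOfIntegers K), Valued.v ((ϖ v : (v.adicCompletion K)ˣ) : v.adicCompletion K) = WithZero.exp (-1 : ℤ)) ∧ Literature.NumberTheory.Automorphic.IsHeckePoint (Matrix.GeneralLinearGroup.map (n := Fin 2) (algebraMap K (IsDedekindDomain.FiniteAdeleRing (NumberField.RingOfIntegers K) K))) (Literature.NumberTheory.Automorphic.LevelTower.ofSeq U (fun r : ℕ => (Literature.NumberTheory.Automorphic.principalCongruenceLevel 2 K (Ideal.span {((2 : ℕ) : NumberField.RingOfIntegers K)} ^ r)).map (Literature.NumberTheory.Automorphic.GLn.sndHom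 2 K))) ((2 : ℕ) : (Valued.v (R := PadicAlgCl 2)).valuationSubring) (fun j : {v : IsDedekindDomain.HeightOneSpectrum (NumberField.RingOfIntegers K) // ∀ ℓ ∈ S₀, ((ℓ : ℕ) : NumberField.RingOfIntegers K) ∉ v.asIdeal} × Fin 2 => Literature.NumberTheory.Automorphic.GLn.sndHom 2 K (Literature.NumberTheory.Automorphic.heckeDiagAt 2 K j.1.1 (ϖ j.1.1) (j.2.val + 1))) (fun j => a j.1 (j.2.val + 1)) ∧ ∀ (v : IsDedekindDomain.HeightOneSpectrum (NumberField.RingOfIntegers K)) (hv : ∀ ℓ ∈ S₀, ((ℓ : ℕ) : NumberField.RingOfIntegers K) ∉ v.asIdeal), σ.IsHeckeAssociatedAt v (fun i : ℕ => if i = 0 then (1 : PadicAlgCl 2) else ((a ⟨v, hv⟩ i : (Valued.v (R := PadicAlgCl 2)).valuationSubring) : PadicAlgCl 2))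

/-- item stmt-Langlands-16619 · crux · rank 3 · open · by planner
why it might fail: Singular-weight classicality over a field with a complex place: no Shimura variety, no q-expansion/companion-form gluing (BuzzardTaylor1999 is ℚ-only), no p-adic LGC at singular weight (AllenKhareThorne2021WeightOne §1); every good place demanded; for even ρ no base-change shortcut.
sources: AllenKhareThorne2021WeightOne §1, Scholze2015 §1, Calegari2023 §12, HansenUniversalEigenvarieties2017 Conj. 1.2.3, BuzzardTaylor1999, CalegariMazur2008 Cor. 1.4
[crux] (R″, rev 10 — the open core of the former R′ ArtinWeightRealisationLevel,
stmt-Langlands-15111, narrowed to the instance `closes` consumes) p prime, ι : ℚ̄_p ≃ ℂ; ρ : Γ_ℚ →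
GL₂(ℂ) irreducible, projective image A₅, EVEN (det ρ(c) = 1 at complex conjugation); K imaginary
quadratic; σ : Γ_K → GL₂(ℚ̄_p) the entrywise ι-model of ρ|_K, finite image, irreducible; S₀ a finite
set of naturals with p ∈ S₀ and 0 ∉ S₀ (good places = places of K over no element of S₀). If σ is
p-adically automorphic of tame level S₀ (the conclusion package of TwoAdicBianchiProModularityLevel
verbatim with 2 ↦ p: U hyperspecial at the good places, uniformisers, a continuous 𝒪_{ℚ̄_p}-point of
Spf 𝕋(U^p) of the p-power Bianchi tower Hansen-associated with σ at every good v) then some cuspidal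
π of GL₂(𝔸_K) has SatakeFrobCompatibleAt ι π σ w at EVERY good place w (Artin type, weight 0 at the
complex place). Implied by R′ (all finite-image σ; pure specialisation), hence by the shared a.e.
crux RuelleTorsionArtinWeight.ArtinWeightRealisation (stmt-Langlands-11057) + Jacquet–Langlands
rigidity (tree p121004), and by strong Artin over K. Contains NO in-print sector: solvable images
excluded (A₅), restrictions of -/
@[route_item "route-Langlands-ParityBlindBianchi", crux]
def ArtinWeightRealisationEven : Prop :=
  ∀ (p : ℕ) [Fact p.Prime] (ι : PadicAlgCl p ≃+* ℂ) (ρ : Literature.NumberTheory.GaloisRepresentations.FramedGaloisRep ℚ ℂ 2), ρ.toGaloisRep.IsIrreducible → Nonempty ((Matrix.ProjGenLinGroup.mk.comp ρ.toMonoidHom).range ≃* alternatingGroup (Fin 5)) → (∀ (φ : ℚ →+* ℝ) (c : Field.absoluteGaloisGroup ℚ), Literature.NumberTheory.GaloisRepresentations.IsComplexConjugation φ c → Matrix.GeneralLinearGroup.det (ρ c) = 1) → ∀ (K : Type) [Field K] [NumberField K], NumberField.IsTotallyComplex K → Module.finrank ℚ K = 2 → ∀ (σ : Literature.NumberTheory.GaloisRepresentations.FramedGaloisRep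 K (PadicAlgCl p) 2), (∀ (g : Field.absoluteGaloisGroup K) (i j : Fin 2), ι ((σ g).val i j) = ((Literature.NumberTheory.GaloisRepresentations.FramedGaloisRep.restrictField K ρ) g).val i j) → Finite σ.toMonoidHom.range → σ.toGaloisRep.IsIrreducible → ∀ S₀ : Finset ℕ, p ∈ S₀ → (0 : ℕ) ∉ S₀ → (∃ (U : Subgroup (GL (Fin 2) (IsDedekindDomain.FiniteAdeleRing (NumberField.RingOfIntegers K) K))) (ϖ : ∀ v : IsDedekindDomain.HeightOneSpectrum (NumberField.RingOfIntegers K), (v.adicCompletion K)ˣ) (a : {v : IsDedekindDomain.HeightOneSpectrum (NumberField.RingOfIntegers K) // ∀ ℓ ∈ S₀, ((ℓ : ℕ) : NumberField.RingOfIntegers K) ∉ v.asIdeal} → ℕ → (Valued.v (R := PadicAlgCl p)).valuationSubring), IsOpen (U : Set (GL (Fin 2) (IsDedekindDomain.FiniteAdeleRing (NumberField.RingOfIntegers K) K))) ∧ U ≤ Literature.NumberTheory.Automorphic.glFiniteIntegralLevel 2 K ∧ (∀ g ∈ Literature.NumberTheory.Automorphic.glFiniteIntegralLevel 2 K, (∀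 v : IsDedekindDomain.HeightOneSpectrum (NumberField.RingOfIntegers K), ¬ (∀ ℓ ∈ S₀, ((ℓ : ℕ) : NumberField.RingOfIntegers K) ∉ v.asIdeal) → ∀ i j : Fin 2, ((g : Matrix (Fin 2) (Fin 2) (IsDedekindDomain.FiniteAdeleRing (NumberField.RingOfIntegers K) K)) i j) v = (1 : Matrix (Fin 2) (Fin 2) (v.adicCompletion K)) i j) → g ∈ U) ∧ (∀ v : IsDedekindDomain.HeightOneSpectrum (NumberField.RingOfIntegers K), Valued.v ((ϖ v : (v.adicCompletion K)ˣ) : v.adicCompletion K) = WithZero.exp (-1 : ℤ)) ∧ Literature.NumberTheory.Automorphic.IsHeckePoint (Matrix.GeneralLinearGroup.map (n := Fin 2) (algebraMap K (IsDedekindDomain.FiniteAdeleRing (NumberField.RingOfIntegers K) K))) (Literature.NumberTheory.Automorphic.LevelTower.ofSeq U (fun r : ℕ => (Literature.NumberTheory.Automorphic.principalCongruenceLevel 2 K (Ideal.span {((p : ℕ) : NumberField.RingOfIntegers K)} ^ r)).map (Literature.NumberTheory.Automorphic.GLn.sndHom 2 K))) ((p : ℕ) : (Valued.v (R := PadicAlgCl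 p)).valuationSubring) (fun j : {v : IsDedekindDomain.HeightOneSpectrum (NumberField.RingOfIntegers K) // ∀ ℓ ∈ S₀, ((ℓ : ℕ) : NumberField.RingOfIntegers K) ∉ v.asIdeal} × Fin 2 => Literature.NumberTheory.Automorphic.GLn.sndHom 2 K (Literature.NumberTheory.Automorphic.heckeDiagAt 2 K j.1.1 (ϖ j.1.1) (j.2.val + 1))) (fun j => a j.1 (j.2.val + 1)) ∧ ∀ (v : IsDedekindDomain.HeightOneSpectrum (NumberField.RingOfIntegers K)) (hv : ∀ ℓ ∈ S₀, ((ℓ : ℕ) : NumberField.RingOfIntegers K) ∉ v.asIdeal), σ.IsHeckeAssociatedAt v (fun i : ℕ => if i = 0 then (1 : PadicAlgCl p) else ((a ⟨v, hv⟩ i : (Valued.v (R := PadicAlgCl p)).valuationSubring) : PadicAlgCl p))) → ∃ (hcpt : Literature.NumberTheory.Automorphic.isCompact_glFiniteIntegralLevel 2 K) (π : Literature.NumberTheory.Automorphic.CuspidalAutomorphicRepData 2 K hcpt), ∀ w : IsDedekindDomain.HeightOneSpectrum (NumberField.RingOfIntegers K), (∀ ℓ ∈ S₀, ((ℓ : ℕ)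 : NumberField.RingOfIntegers K) ∉ w.asIdeal) → SatakeFrobCompatibleAt ι π.1 σ w

/-- item stmt-Langlands-16811 · crux · rank 4 · open · by planner
why it might fail: Theorem in print (Langlands 1980; Arthur–Clozel III.4.2(d), p.173) with NO L-function proof: descent IS the twisted trace formula, XL to formalise even at n = 2; as typed it fails only by drift of the Borel–Jacquet data (free |det|^s twist, a.e. Satake shadow of Π ≅ Π∘σ, weak lift a.e.).
sources: LanglandsBaseChange1980, ArthurClozelAMS120 Ch. 3 Thm 4.2 (d) (p. 173), Gelbart1997 Thm 6.1 (c), JacquetShalikaAJM1981II Prop. 3.6 / Thm 4.4, Literature.NumberTheory.Automorphic.cuspidal_descent_cyclic_of_clean_leaves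
[crux] (PROMOTED rev 10, route-choice a6bd8d4f) Quadratic DESCENT for GL₂: for a number field F, E/F
Galois with [E:F] = 2 and a cuspidal P on GL₂(𝔸_E) whose Satake data are Gal(E/F)-stable a.e.
(IsGaloisStableSatakeAE, the shadow of P ≅ P^σ), there is a cuspidal π on GL₂(𝔸_F) of which P is a
weak base-change lift (IsWeakBaseChangeLiftAE). Verbatim the n = 2, [E:F] = 2 case of the tree fact
Literature.NumberTheory.Automorphic.cuspidal_descent_cyclic (Arthur–Clozel Ch. 3 Thm 4.2 (d);
Langlands 1980; Gelbart1997 Thm 6.1 (c)), hence implied by it (finrank 2 ⇒ prime degree and cyclic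
Galois group); printed proof = twisted trace formula for GL₂ (no L-function proof of descent is
known). Consumed by IcosahedralDescentLevelBC (anchor descent from K₁ = ℚ(√−D₁)). [difficulty: XL,
theorem in print] (why it might fail: Theorem in print (Langlands 1980; A–C III.4.2(d)); can fail
only by vocabulary drift: free central twist |det|^s in CuspidalAutomorphicRepData, a.e. Satake
shadow for P ≅ P^σ (SMO used inside the proof). Implied verbatim by tree fact
cuspidal_descent_cyclic at n = 2.) [sources: LanglandsBaseChange1980, ArthurClozelAMS120 Ch. 3 Thm
4.2 (d), Gelbart1997 Thm 6.1 (c), JacquetShalik -/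
@[route_item "route-Langlands-ParityBlindBianchi", crux]
def QuadraticDescentGL2 : Prop :=
  ∀ (F E : Type) [Field F] [NumberField F] [Field E] [NumberField E] [Algebra F E] [IsGalois F E], Module.finrank F E = 2 → ∀ (hF : Literature.NumberTheory.Automorphic.isCompact_glFiniteIntegralLevel 2 F) (hE : Literature.NumberTheory.Automorphic.isCompact_glFiniteIntegralLevel 2 E) (P : Literature.NumberTheory.Automorphic.CuspidalAutomorphicRepData 2 E hE), Literature.NumberTheory.Automorphic.IsGaloisStableSatakeAE F P.1 → ∃ π : Literature.NumberTheory.Automorphic.CuspidalAutomorphicRepData 2 F hF, Literature.NumberTheory.Automorphic.IsWeakBaseChangeLiftAE π.1 P.1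

/-- item stmt-Langlands-16812 · crux · rank 5 · open · by planner
why it might fail: Theorems in print (Langlands 1980; A–C III.4.2(a), III.5.1; lifting also by Jacquet 1972 converse theorem over E), XL to formalise; as typed only drift can bite: the inert witness α ≠ −α must force π ≇ π ⊗ η (it does), strong lifting asserted for ANY cuspidal weak lift P (= BC(π) by SMO).
sources: LanglandsBaseChange1980, ArthurClozelAMS120 Ch. 3 Thm 4.2 (a), Thm 5.1, Ch. 1 §6–7, Jacquet1972, Gelbart1997 §6
[crux] (PROMOTED rev 10, route-choice a6bd8d4f: the harness judged baseChange_cyclic_cuspidal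
XL-apex — it reduces only to its L² twin ArthurClozel1989_weakLifting_cuspidal, the trace-formula
comparison for all n) Quadratic BASE CHANGE for GL₂, F a number field, E/F Galois with [E:F] = 2,
four clauses = the n = 2 specialisations of the tree facts: (a) baseChange_cyclic_cuspidal (A–C
III.4.2 (a)): a cuspidal π on GL₂(𝔸_F) with a Satake parameter α ≠ −α (as multisets) at ONE place
inert in E has, for every hE, a CUSPIDAL weak lift P on GL₂(𝔸_E); (b)
ArthurClozel1989_strongLifting_unramified (III.5.1 + I §6): a cuspidal weak lift is an unramified
strong lift (IsUnramifiedBaseChangeLift) and unramifiedness descends at places unramified in E; (c)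
…_allFinite: t_{P,w} = t_{π,v}^{f(w|v)} at EVERY finite w over v with π_v unramified, v ramified in
E allowed; (d) …_archimedean (III.5.1 + I §7): archimedean parameters restrict, χ_P(τ) = χ_π(τ|_F).
Each clause is implied verbatim by its tree fact at (2, F, E). Consumed by
ResidualBianchiDoorLevelBC ((a),(c),(d) at (ℚ, K): BC_K(π_f) cuspidal, regular algebraic, congruent
at every good place incl. those ramified in K/ℚ) and IcosahedralDescentLe -/
@[route_item "route-Langlands-ParityBlindBianchi", crux]
def QuadraticBaseChangeGL2 : Prop :=
  (∀ (F E : Type) [Field F] [NumberField F] [Field E] [NumberField E] [Algebra F E] [IsGalois F E], Module.finrank F E = 2 → ∀ (hF : Literature.NumberTheory.Automorphic.isCompact_glFiniteIntegralLevel 2 F) (π : Literature.NumberTheory.Automorphic.CuspidalAutomorphicRepData 2 F hF), (∃ (v : IsDedekindDomain.HeightOneSpectrum (NumberField.RingOfIntegers F)) (w : IsDedekindDomain.HeightOneSpectrum (NumberField.RingOfIntegers E)) (α : Multiset ℂ), w.asIdeal.under (NumberField.RingOfIntegers F) = v.asIdeal ∧ w.asIdeal.inertiaDeg (NumberField.RingOfIntegers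 F) = Module.finrank F E ∧ π.1.HasSatakeParamAt v α ∧ ∀ ζ : ℂ, IsPrimitiveRoot ζ (Module.finrank F E) → α.map (ζ * ·) ≠ α) → ∀ (hE : Literature.NumberTheory.Automorphic.isCompact_glFiniteIntegralLevel 2 E), ∃ P : Literature.NumberTheory.Automorphic.CuspidalAutomorphicRepData 2 E hE, Literature.NumberTheory.Automorphic.IsWeakBaseChangeLiftAE π.1 P.1) ∧ (∀ (F E : Type) [Field F] [NumberField F] [Field E] [NumberField E] [Algebra F E] [IsGalois F E], Module.finrank F E = 2 → ∀ (hF : Literature.NumberTheory.Automorphic.isCompact_glFiniteIntegralLevel 2 F) (hE : Literature.NumberTheory.Automorphic.isCompact_glFiniteIntegralLevel 2 E) (π : Literature.NumberTheory.Automorphic.CuspidalAutomorphicRepData 2 F hF) (P : Literature.NumberTheory.Automorphic.CuspidalAutomorphicRepData 2 E hE), Literature.NumberTheory.Automorphic.IsWeakBaseChangeLiftAE π.1 P.1 → Literature.NumberTheory.Automorphic.IsUnramifiedBaseChangeLift π.1 P.1 ∧ ∀ v : IsDedekindDomain.HeightOneSpectrum (NumberField.RingOfIntegers F), Algebra.IsUnramifiedIn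 (NumberField.RingOfIntegers E) v.asIdeal → (∀ w : IsDedekindDomain.HeightOneSpectrum (NumberField.RingOfIntegers E), w.asIdeal.under (NumberField.RingOfIntegers F) = v.asIdeal → P.1.IsUnramifiedAt w) → π.1.IsUnramifiedAt v) ∧ (∀ (F E : Type) [Field F] [NumberField F] [Field E] [NumberField E] [Algebra F E] [IsGalois F E], Module.finrank F E = 2 → ∀ (hF : Literature.NumberTheory.Automorphic.isCompact_glFiniteIntegralLevel 2 F) (hE : Literature.NumberTheory.Automorphic.isCompact_glFiniteIntegralLevel 2 E) (π : Literature.NumberTheory.Automorphic.CuspidalAutomorphicRepData 2 F hF) (P : Literature.NumberTheory.Automorphic.CuspidalAutomorphicRepData 2 E hE), Literature.NumberTheory.Automorphic.IsWeakBaseChangeLiftAE π.1 P.1 → ∀ (w : IsDedekindDomain.HeightOneSpectrum (NumberField.RingOfIntegers E)) (v : IsDedekindDomain.HeightOneSpectrum (NumberField.RingOfIntegers F)) (α : Multiset ℂ), w.asIdeal.under (NumberField.RingOfIntegers F) = v.asIdeal → π.1.HasSatakeParamAt v α → P.1.HasSatakeParamAt w (α.map (· ^ w.asIdeal.inertiaDeg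 (NumberField.RingOfIntegers F)))) ∧ (∀ (F E : Type) [Field F] [NumberField F] [Field E] [NumberField E] [Algebra F E] [IsGalois F E], Module.finrank F E = 2 → ∀ (hF : Literature.NumberTheory.Automorphic.isCompact_glFiniteIntegralLevel 2 F) (hE : Literature.NumberTheory.Automorphic.isCompact_glFiniteIntegralLevel 2 E) (π : Literature.NumberTheory.Automorphic.CuspidalAutomorphicRepData 2 F hF) (P : Literature.NumberTheory.Automorphic.CuspidalAutomorphicRepData 2 E hE), Literature.NumberTheory.Automorphic.IsWeakBaseChangeLiftAE π.1 P.1 → ∀ χ : (F →+* ℂ) → Multiset ℂ, π.1.HasArchParameter χ → P.1.HasArchParameter fun τ => χ (τ.comp (algebraMap F E)))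

/-- item stmt-Langlands-16853 · crux · rank 6 · open · by planner
why it might fail: Cannot fail mathematically (facts ⊢ E1′R kernel-checked, p125055); fails only if a use site of baseChange_cyclic_cuspidal / strongLifting_archimedean / _allFinite in p125055's stubs is not at n = 2 (they are: BC_K(π_f), K/ℚ quadratic); khare_wintenberger 2 stays cited (next promotion if ruled apex).
sources: KhareWintenberger2009 Thm 1.2, Kisin2009TwoAdic, ArthurClozelAMS120 Ch. 3 Thm 4.2 (a), 5.1, LanglandsBaseChange1980, p125055
[crux] (E1″, BC-conditional residual door; route-choice rchoice-bc22de8d adopting rchoice-a6bd8d4f's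
ruling, rev 14 package, 2026-08-16) `QuadraticBaseChangeGL2 → <ResidualBianchiDoorLevelR inlined>`
(antecedent = the sibling crux stmt-Langlands-16812 BY NAME, so this item must keep a rank above
its; conclusion = the text of stmt-Langlands-16621 verbatim; `rfl`-equal to `QuadraticBaseChangeGL2
→ ResidualBianchiDoorLevelR`). WHY: the closes-serving proof of E1′R (p125055,
Theorems/ParityBlindBianchiResidualBianchiDoorLevelR.lean: hypotheses khare_wintenberger,
baseChange_cyclic_cuspidal, ArthurClozel1989_strongLifting_archimedean, …_allFinite) rests on the
XL-apex fact baseChange_cyclic_cuspidal, PROMOTED (with the archimedean/allFinite clauses) to the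
crux QuadraticBaseChangeGL2 (clauses (a),(d),(c)); this item is the form of the residual door that
`closes` consumes as `hE1 hQBC : ResidualBianchiDoorLevelR`. PROVABLE NOW modulo `khare_wintenberger
2 k` (Serre's conjecture mod 2 = KhareWintenberger2009 Thm 1.2 + Kisin2009TwoAdic; stays a cited
named fact here — if the harness rules it apex too, it is the next promotion, shared with
EvenArtinGL4Door.ResidualDoorMod2): re-plumb p12505 -/
@[route_item "route-Langlands-ParityBlindBianchi", crux]
def ResidualBianchiDoorLevelBC : Prop :=
  QuadraticBaseChangeGL2 → ∀ (ι : PadicAlgCl 2 ≃+* ℂ) (ρ : Literature.NumberTheory.GaloisRepresentations.FramedGaloisRep ℚ ℂ 2), ρ.toGaloisRep.IsIrreducible → Nonempty ((Matrix.ProjGenLinGroup.mk.comp ρ.toMonoidHom).range ≃* alternatingGroup (Fin 5)) → ∃ S₀ : Finset ℕ, 2 ∈ S₀ ∧ (0 : ℕ) ∉ S₀ ∧ ∀ (K : Type) [Field K] [NumberField K], NumberField.IsTotallyComplex K → Module.finrank ℚ K = 2 → (∃ v w : IsDedekindDomain.HeightOneSpectrum (NumberField.RingOfIntegers K), v ≠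 w ∧ ((2 : ℕ) : NumberField.RingOfIntegers K) ∈ v.asIdeal ∧ ((2 : ℕ) : NumberField.RingOfIntegers K) ∈ w.asIdeal) → ∃ σ : Literature.NumberTheory.GaloisRepresentations.FramedGaloisRep K (PadicAlgCl 2) 2, (∀ (g : Field.absoluteGaloisGroup K) (i j : Fin 2), ι ((σ g).val i j) = ((Literature.NumberTheory.GaloisRepresentations.FramedGaloisRep.restrictField K ρ) g).val i j) ∧ Finite σ.toMonoidHom.range ∧ σ.toGaloisRep.IsIrreducible ∧ Nonempty ((Matrix.ProjGenLinGroup.mk.comp σ.toMonoidHom).range ≃* alternatingGroup (Fin 5)) ∧ ∃ (hcpt : Literature.NumberTheory.Automorphic.isCompact_glFiniteIntegralLevel 2 K) (π₀ : Literature.NumberTheory.Automorphic.CuspidalAutomorphicRepData 2 K hcpt), π₀.1.IsRegularAlgebraic ∧ ∀ v : IsDedekindDomain.HeightOneSpectrum (NumberField.RingOfIntegers K), (∀ ℓ ∈ S₀, ((ℓ : ℕ) : NumberField.RingOfIntegers K) ∉ v.asIdeal) → ∃ (α : Multiset ℂ) (P : Polynomial (PadicAlgCl 2)), π₀.1.HasSatakeParamAt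 v α ∧ σ.IsUnramifiedAt v ∧ σ.HasFrobCharpolyAt v P ∧ ∀ i : ℕ, ‖P.coeff i - (Literature.NumberTheory.Automorphic.arithFrobPolyOfSatake ι v.residueCard 2 α).coeff i‖ < 1

/-- item stmt-Langlands-16852 · crux · rank 7 · open · by planner
why it might fail: Cannot fail mathematically (F1–F4 ⊢ D′R kernel-checked, p111861/p125164); fails only if a use site of the full base-change/descent facts in the landed proof is not at n = 2 — checked: anchor_descent, pair_dichotomy, ReadOff all at (2, ℚ, ℚ(√−D)); F4 (III.3.1, tree-decomposed) stays cited.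
sources: ArthurClozelAMS120 Ch. 3 Thm 3.1, 4.2 (a),(d), 5.1, LanglandsBaseChange1980, p111861, p125164, Literature.NumberTheory.Automorphic.ArthurClozel_fibres_quadratic_holds_of
[crux] (D″, BC-conditional uniform descent; route-choice rchoice-bc22de8d, rev 14 package,
2026-08-16) `QuadraticDescentGL2 → QuadraticBaseChangeGL2 → <IcosahedralDescentLevelR inlined>`
(antecedents = the sibling cruxes stmt-Langlands-16811/16812 BY NAME, so this item must keep a rank
above theirs; conclusion = the text of stmt-Langlands-16620 verbatim; `rfl`-equal to
`QuadraticDescentGL2 → QuadraticBaseChangeGL2 → IcosahedralDescentLevelR`). WHY: the harness ruled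
the Literature fact `cuspidal_descent_cyclic` (and `baseChange_cyclic_cuspidal`,
`ArthurClozel1989_strongLifting_unramified`) XL-apex, so the closes-serving proof of D′R (p125164,
Theorems/ParityBlindBianchiIcosahedralDescentLevelR.lean, hypotheses F1–F4) may not rest on them as
cited facts; they are PROMOTED to the cruxes QuadraticDescentGL2 (F1 at n = 2) /
QuadraticBaseChangeGL2 (F3 = clause (a), F2 = clause (b)), and this item is the form of the descent
step that `closes` consumes as `hD hQD hQBC : IcosahedralDescentLevelR`. PROVABLE NOW modulo the
tree-decomposed F4 `ArthurClozel_fibres_quadratic` (A–C III.3.1; = Jacquet–Shalika (2.2)/(2.3) +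
multiplicity one via `ArthurClozel_fibres_quadratic_holds_of`, which stays -/
@[route_item "route-Langlands-ParityBlindBianchi", crux]
def IcosahedralDescentLevelBC : Prop :=
  QuadraticDescentGL2 → QuadraticBaseChangeGL2 → ∀ (ι : PadicAlgCl 2 ≃+* ℂ) (ρ : Literature.NumberTheory.GaloisRepresentations.FramedGaloisRep ℚ ℂ 2), ρ.toGaloisRep.IsIrreducible → Nonempty ((Matrix.ProjGenLinGroup.mk.comp ρ.toMonoidHom).range ≃* alternatingGroup (Fin 5)) → (∃ S₀ : Finset ℕ, (0 : ℕ) ∉ S₀ ∧ ∀ (K : Type) [Field K] [NumberField K], NumberField.IsTotallyComplex K → Module.finrank ℚ K = 2 → (∃ v w : IsDedekindDomain.HeightOneSpectrum (NumberField.RingOfIntegers K), v ≠ w ∧ ((2 : ℕ) : NumberField.RingOfIntegers K) ∈ v.asIdeal ∧ ((2 : ℕ) : NumberField.RingOfIntegers K) ∈ w.asIdeal) → ∃ (σ : Literature.NumberTheory.GaloisRepresentations.FramedGaloisRep K (PadicAlgCl 2) 2) (hcpt : Literature.NumberTheory.Automorphic.isCompact_glFiniteIntegralLevel 2 K) (π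 : Literature.NumberTheory.Automorphic.CuspidalAutomorphicRepData 2 K hcpt), (∀ (g : Field.absoluteGaloisGroup K) (i j : Fin 2), ι ((σ g).val i j) = ((Literature.NumberTheory.GaloisRepresentations.FramedGaloisRep.restrictField K ρ) g).val i j) ∧ ∀ w : IsDedekindDomain.HeightOneSpectrum (NumberField.RingOfIntegers K), (∀ ℓ ∈ S₀, ((ℓ : ℕ) : NumberField.RingOfIntegers K) ∉ w.asIdeal) → Summit.Langlands.SatakeFrobCompatibleAt ι π.1 σ w) → ∃ (hcpt : Literature.NumberTheory.Automorphic.isCompact_glFiniteIntegralLevel 2 ℚ) (π : Literature.NumberTheory.Automorphic.CuspidalAutomorphicRepData 2 ℚ hcpt), (∀ᶠ v : IsDedekindDomain.HeightOneSpectrum (NumberField.RingOfIntegers ℚ) in Filter.cofinite, ∃ α : Multiset ℂ, π.1.HasSatakeParamAt v α ∧ ρ.IsUnramifiedAt v ∧ ρ.HasFrobCharpolyAt v (Literature.NumberTheory.Automorphic.satakePolynomial α))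

/-- item stmt-Langlands-2908 · crux · rank 9 · open · by planner
why it might fail: The rest of the summit: Langlands = GL_n reciprocity over all number fields, both directions, every finite place; it fails if (A) fails for a non-regular π (no Galois representations known) or (B)/LGC fails beyond the regular polarisable world — while even icosahedral strong Artin holds.
sources: BuzzardGeeLMS2014 Conj. 3.2.1/3.2.2, FontaineMazurGeometric1995 Conj. 1, Calegari2023 §12, Summits/Langlands/Langlands/Statement.lean (def Langlands)
[support] X → Langlands: the rest of the summit (regular / totally-real–CM sectors, other n and F,
direction (A), and the upgrade of the a.e. `IsPiOfArtinRep` to `Corresponds` at every finite place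
by local–global compatibility + strong multiplicity one). Not this route's business; filed so that
the Assembly ends in the summit constant; shared junction for every even-Artin card. [difficulty:
open-problem] -/
@[route_item "route-Langlands-ParityBlindBianchi", crux]
def EvenArtinJunction : Prop :=
  (∀ ρ : Literature.NumberTheory.GaloisRepresentations.FramedGaloisRep ℚ ℂ 2, ρ.toGaloisRep.IsIrreducible → Nonempty ((Matrix.ProjGenLinGroup.mk.comp ρ.toMonoidHom).range ≃* alternatingGroup (Fin 5)) → (∀ (φ : ℚ →+* ℝ) (c : Field.absoluteGaloisGroup ℚ), Literature.NumberTheory.GaloisRepresentations.IsComplexConjugation φ c → Matrix.GeneralLinearGroup.det (ρ c) = 1) → ∃ (hcpt : Literature.NumberTheory.Automorphic.isCompact_glFiniteIntegralLevel 2 ℚ) (π : Literature.NumberTheory.Automorphic.CuspidalAutomorphicRepData 2 ℚ hcpt), (∀ᶠ v : IsDedekindDomain.HeightOneSpectrum (NumberField.RingOfIntegers ℚ) in Filter.cofinite, ∃ α : Multiset ℂ, π.1.HasSatakeParamAt v α ∧ ρ.IsUnramifiedAt v ∧ ρ.HasFrobCharpolyAt v (Literature.NumberTheory.Automorphic.satakePolynomial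 α))) → _root_.Langlands

/-- item stmt-Langlands-15111 · support · rank 3 · open · by planner
why it might fail: As typed it has a junk zero sector (0 ∈ S₀: no good place, empty Hecke family) that forces the bare existence of Bianchi cusp forms (Negative/ZeroSector); its honest core is the non-regular-weight wall shared with item 11057 (R′ → R unconditional p108329; R → JL → R′ p121004).
sources: AllenKhareThorne2021WeightOne §1, Scholze2015 §1, Calegari2023 §12, HansenUniversalEigenvarieties2017, BuzzardTaylor1999, Literature.Barriers.Langlands.NonRegularWeightBarrier
[crux] (R′, rev 8) K imaginary quadratic, p prime, ι : ℚ̄_p ≃ ℂ, σ : Γ_K → GL₂(ℚ̄_p) finite image,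
irreducible; S₀ ∋ p a finite set of rational primes. If σ is p-adically automorphic of tame level S₀
(the conclusion package of TwoAdicBianchiProModularityLevel verbatim with 2 ↦ p: U hyperspecial at
the good places, continuous 𝒪_{ℚ̄_p}-point of Spf 𝕋(U^p) of the p-power tower, Hansen-associated
with σ at every good v) then some cuspidal π of GL₂(𝔸_K) has SatakeFrobCompatibleAt ι π σ w at EVERY
good place w (Artin type, weight 0 at the complex place). Route-local sharpening of the shared
ArtinWeightRealisation (stmt-Langlands-11057: a.e. conclusion; kept verbatim by
RuelleTorsionArtinWeight): the uniform descent needs every good place. Used at p = 2. [deps: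
TwoAdicBianchiProModularityLevel] [difficulty: open-problem] -/
@[route_item "route-Langlands-ParityBlindBianchi", crux]
def ArtinWeightRealisationLevel : Prop :=
  ∀ (K : Type) [Field K] [NumberField K], NumberField.IsTotallyComplex K → Module.finrank ℚ K = 2 → ∀ (p : ℕ) [Fact p.Prime] (ι : PadicAlgCl p ≃+* ℂ) (σ : Literature.NumberTheory.GaloisRepresentations.FramedGaloisRep K (PadicAlgCl p) 2), Finite σ.toMonoidHom.range → σ.toGaloisRep.IsIrreducible → ∀ S₀ : Finset ℕ, p ∈ S₀ → (∃ (U : Subgroup (GL (Fin 2) (IsDedekindDomain.FiniteAdeleRing (NumberField.RingOfIntegers K) K))) (ϖ : ∀ v : IsDedekindDomain.HeightOneSpectrum (NumberField.RingOfIntegers K), (v.adicCompletion K)ˣ) (a : {v : IsDedekindDomain.HeightOneSpectrum (NumberField.RingOfIntegers K) // ∀ ℓ ∈ S₀, ((ℓ : ℕ) : NumberField.RingOfIntegers K) ∉ v.asIdeal} → ℕ → (Valued.v (R := PadicAlgCl p)).valuationSubring), IsOpen (U : Set (GL (Fin 2) (IsDedekindDomain.FiniteAdeleRing (NumberField.RingOfIntegers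 K) K))) ∧ U ≤ Literature.NumberTheory.Automorphic.glFiniteIntegralLevel 2 K ∧ (∀ g ∈ Literature.NumberTheory.Automorphic.glFiniteIntegralLevel 2 K, (∀ v : IsDedekindDomain.HeightOneSpectrum (NumberField.RingOfIntegers K), ¬ (∀ ℓ ∈ S₀, ((ℓ : ℕ) : NumberField.RingOfIntegers K) ∉ v.asIdeal) → ∀ i j : Fin 2, ((g : Matrix (Fin 2) (Fin 2) (IsDedekindDomain.FiniteAdeleRing (NumberField.RingOfIntegers K) K)) i j) v = (1 : Matrix (Fin 2) (Fin 2) (v.adicCompletion K)) i j) → g ∈ U) ∧ (∀ v : IsDedekindDomain.HeightOneSpectrum (NumberField.RingOfIntegers K), Valued.v ((ϖ v : (v.adicCompletion K)ˣ) : v.adicCompletion K) = WithZero.exp (-1 : ℤ)) ∧ Literature.NumberTheory.Automorphic.IsHeckePoint (Matrix.GeneralLinearGroup.map (n := Fin 2) (algebraMap K (IsDedekindDomain.FiniteAdeleRing (NumberField.RingOfIntegers K) K))) (Literature.NumberTheory.Automorphic.LevelTower.ofSeq U (fun r : ℕ => (Literature.NumberTheory.Automorphic.principalCongruenceLevel 2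 K (Ideal.span {((p : ℕ) : NumberField.RingOfIntegers K)} ^ r)).map (Literature.NumberTheory.Automorphic.GLn.sndHom 2 K))) ((p : ℕ) : (Valued.v (R := PadicAlgCl p)).valuationSubring) (fun j : {v : IsDedekindDomain.HeightOneSpectrum (NumberField.RingOfIntegers K) // ∀ ℓ ∈ S₀, ((ℓ : ℕ) : NumberField.RingOfIntegers K) ∉ v.asIdeal} × Fin 2 => Literature.NumberTheory.Automorphic.GLn.sndHom 2 K (Literature.NumberTheory.Automorphic.heckeDiagAt 2 K j.1.1 (ϖ j.1.1) (j.2.val + 1))) (fun j => a j.1 (j.2.val + 1)) ∧ ∀ (v : IsDedekindDomain.HeightOneSpectrum (NumberField.RingOfIntegers K)) (hv : ∀ ℓ ∈ S₀, ((ℓ : ℕ) : NumberField.RingOfIntegers K) ∉ v.asIdeal), σ.IsHeckeAssociatedAt v (fun i : ℕ => if i = 0 then (1 : PadicAlgCl p) else ((a ⟨v, hv⟩ i : (Valued.v (R := PadicAlgCl p)).valuationSubring) : PadicAlgCl p))) → ∃ (hcpt : Literature.NumberTheory.Automorphic.isCompact_glFiniteIntegralLevel 2 K) (π : Literature.NumberTheory.Automorphic.CuspidalAutomorphicRepData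 2 K hcpt), ∀ w : IsDedekindDomain.HeightOneSpectrum (NumberField.RingOfIntegers K), (∀ ℓ ∈ S₀, ((ℓ : ℕ) : NumberField.RingOfIntegers K) ∉ w.asIdeal) → SatakeFrobCompatibleAt ι π.1 σ w

/-- item stmt-Langlands-15112 · support · rank 4 · open · by planner
why it might fail: Theorem in print (KW+Kisin mod 2, base change, Deligne) but as TYPED (no 0 ∉ S₀) witnessed vacuously by S₀ = {0, 2} (Negative/LoopholeRegAlgCuspidal); the honest text is E1′R stmt-16621 / E1″ stmt-16853.
sources: KhareWintenberger2009 Thm 1.2, KhareWintenberger2009II, Kisin2009TwoAdic, LanglandsBaseChange1980, Deligne1971, HarrisLanTaylorThorneRMS2016 Thm A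
[crux] (E1′, rev 8; theorem-sized residual rung made UNIFORM in K; crux by the crux-only rule) ρ :
Γ_ℚ → GL₂(ℂ) irreducible of icosahedral type, ι : ℚ̄₂ ≃ ℂ. Then there is a finite set of rational
primes S₀ ∋ 2 (from ρ alone: 2, the conductor of ρ, the level of the KW newform) such that for every
imaginary quadratic K with 2 split: σ := ι⁻¹ ∘ ρ|_K entrywise is a framed Galois representation over
ℚ̄₂ (finite image, hence continuous), irreducible with projective image A₅ (A₅ simple, no index-2
subgroup), and some regular algebraic cuspidal π₀ of GL₂(𝔸_K) (namely BC_K(π_f)) is congruent to σ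
at EVERY good place — the residual hypothesis of TwoAdicBianchiProModularityLevel verbatim. In
print: ρ̄₂ irreducible with projective image SL₂(𝔽₄), odd for free ⇒ modular (KhareWintenberger2009
Thm 1.2, KhareWintenberger2009II, Kisin2009TwoAdic), f non-CM; BC_K(π_f) regular algebraic cuspidal
(LanglandsBaseChange1980), unramified at every good place (also at those ramified in K/ℚ); Deligne's
ρ_f|_K in the HLTT normalisation (arithFrobPolyOfSatake ι q 2 α) is congruent to σ at every good
place since the residual representations agree pointwise; √q and cyclotomic twists ≡ 1 mod the
maximal ideal of -/
@[route_item "route-Langlands-ParityBlindBianchi", crux]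
def ResidualBianchiDoorLevel : Prop :=
  ∀ (ι : PadicAlgCl 2 ≃+* ℂ) (ρ : Literature.NumberTheory.GaloisRepresentations.FramedGaloisRep ℚ ℂ 2), ρ.toGaloisRep.IsIrreducible → Nonempty ((Matrix.ProjGenLinGroup.mk.comp ρ.toMonoidHom).range ≃* alternatingGroup (Fin 5)) → ∃ S₀ : Finset ℕ, 2 ∈ S₀ ∧ ∀ (K : Type) [Field K] [NumberField K], NumberField.IsTotallyComplex K → Module.finrank ℚ K = 2 → (∃ v w : IsDedekindDomain.HeightOneSpectrum (NumberField.RingOfIntegers K), v ≠ w ∧ ((2 : ℕ) : NumberField.RingOfIntegers K) ∈ v.asIdeal ∧ ((2 : ℕ) : NumberField.RingOfIntegers K) ∈ w.asIdeal) → ∃ σ : Literature.NumberTheory.GaloisRepresentations.FramedGaloisRep K (PadicAlgCl 2) 2, (∀ (g : Field.absoluteGaloisGroup K) (i j : Fin 2), ι ((σ g).val i j) = ((Literature.NumberTheory.GaloisRepresentations.FramedGaloisRep.restrictField K ρ) g).val i j) ∧ Finite σ.toMonoidHom.range ∧ σ.toGaloisRep.IsIrreducible ∧ Nonempty ((Matrix.ProjGenLinGroup.mk.comp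 σ.toMonoidHom).range ≃* alternatingGroup (Fin 5)) ∧ ∃ (hcpt : Literature.NumberTheory.Automorphic.isCompact_glFiniteIntegralLevel 2 K) (π₀ : Literature.NumberTheory.Automorphic.CuspidalAutomorphicRepData 2 K hcpt), π₀.1.IsRegularAlgebraic ∧ ∀ v : IsDedekindDomain.HeightOneSpectrum (NumberField.RingOfIntegers K), (∀ ℓ ∈ S₀, ((ℓ : ℕ) : NumberField.RingOfIntegers K) ∉ v.asIdeal) → ∃ (α : Multiset ℂ) (P : Polynomial (PadicAlgCl 2)), π₀.1.HasSatakeParamAt v α ∧ σ.IsUnramifiedAt v ∧ σ.HasFrobCharpolyAt v P ∧ ∀ i : ℕ, ‖P.coeff i - (Literature.NumberTheory.Automorphic.arithFrobPolyOfSatake ι v.residueCard 2 α).coeff i‖ < 1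

/-- item stmt-Langlands-16621 · support · rank 4 · open · by planner
why it might fail: In print (KW+Kisin mod 2, cyclic base change, Deligne); fails only as TYPED: σ = ι⁻¹ρ|_K entrywise (no conjugation freedom), congruence at ALL good places incl. K-ramified ones in the HLTT normalisation, BC(π_f) regular algebraic needs even weight; or a cited fact is mis-stated.
sources: KhareWintenberger2009 Thm 1.2, KhareWintenberger2009II, Kisin2009TwoAdic, LanglandsBaseChange1980, ArthurClozelAMS120 Ch. 3 Thm 4.2(a), 5.1, Deligne1971
[crux] (E1′R, rev 10 = E1′ ResidualBianchiDoorLevel stmt-Langlands-15112 with `(0 : ℕ) ∉ S₀` added;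
theorem-sized residual rung made UNIFORM in K; crux by the crux-only rule) ρ : Γ_ℚ → GL₂(ℂ)
irreducible of icosahedral type, ι : ℚ̄₂ ≃ ℂ. Then there is a finite set S₀ of naturals with 2 ∈ S₀
and 0 ∉ S₀ (from ρ alone: 2, the conductor of ρ, the level of the KW newform) such that for every
imaginary quadratic K with 2 split: σ := ι⁻¹ ∘ ρ|_K entrywise is a framed Galois representation over
ℚ̄₂ (finite image), irreducible with projective image A₅, and some regular algebraic cuspidal π₀ of
GL₂(𝔸_K) (namely BC_K(π_f)) is congruent to σ at EVERY good place — the residual hypothesis of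
TwoAdicBianchiProModularityLevel verbatim. In print: ρ̄₂ irreducible with projective image SL₂(𝔽₄),
odd for free ⇒ modular (KhareWintenberger2009 Thm 1.2, KhareWintenberger2009II, Kisin2009TwoAdic), f
non-CM; BC_K(π_f) regular algebraic cuspidal (LanglandsBaseChange1980 / tree
baseChange_cyclic_cuspidal + ArthurClozel1989_strongLifting_archimedean), unramified at every good
place (also at those ramified in K/ℚ: ArthurClozel1989_strongLifting_allFinite/unramified);
Deligne's ρ_f|_K in the HLTT normalisation (a -/
@[route_item "route-Langlands-ParityBlindBianchi"]
def ResidualBianchiDoorLevelR : Prop :=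
  ∀ (ι : PadicAlgCl 2 ≃+* ℂ) (ρ : Literature.NumberTheory.GaloisRepresentations.FramedGaloisRep ℚ ℂ 2), ρ.toGaloisRep.IsIrreducible → Nonempty ((Matrix.ProjGenLinGroup.mk.comp ρ.toMonoidHom).range ≃* alternatingGroup (Fin 5)) → ∃ S₀ : Finset ℕ, 2 ∈ S₀ ∧ (0 : ℕ) ∉ S₀ ∧ ∀ (K : Type) [Field K] [NumberField K], NumberField.IsTotallyComplex K → Module.finrank ℚ K = 2 → (∃ v w : IsDedekindDomain.HeightOneSpectrum (NumberField.RingOfIntegers K), v ≠ w ∧ ((2 : ℕ) : NumberField.RingOfIntegers K) ∈ v.asIdeal ∧ ((2 : ℕ) : NumberField.RingOfIntegers K) ∈ w.asIdeal) → ∃ σ : Literature.NumberTheory.GaloisRepresentations.FramedGaloisRep K (PadicAlgCl 2) 2, (∀ (g : Field.absoluteGaloisGroup K) (i j : Fin 2), ι ((σ g).val i j) = ((Literature.NumberTheory.GaloisRepresentations.FramedGaloisRep.restrictField K ρ) g).val i j) ∧ Finite σ.toMonoidHom.range ∧ σ.toGaloisRep.IsIrreducible ∧ Nonempty ((Matrix.ProjGenLinGroup.mk.comp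 σ.toMonoidHom).range ≃* alternatingGroup (Fin 5)) ∧ ∃ (hcpt : Literature.NumberTheory.Automorphic.isCompact_glFiniteIntegralLevel 2 K) (π₀ : Literature.NumberTheory.Automorphic.CuspidalAutomorphicRepData 2 K hcpt), π₀.1.IsRegularAlgebraic ∧ ∀ v : IsDedekindDomain.HeightOneSpectrum (NumberField.RingOfIntegers K), (∀ ℓ ∈ S₀, ((ℓ : ℕ) : NumberField.RingOfIntegers K) ∉ v.asIdeal) → ∃ (α : Multiset ℂ) (P : Polynomial (PadicAlgCl 2)), π₀.1.HasSatakeParamAt v α ∧ σ.IsUnramifiedAt v ∧ σ.HasFrobCharpolyAt v P ∧ ∀ i : ℕ, ‖P.coeff i - (Literature.NumberTheory.Automorphic.arithFrobPolyOfSatake ι v.residueCard 2 α).coeff i‖ < 1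

/-- item stmt-Langlands-15113 · support · rank 5 · open · by planner
why it might fail: MISSTATED: without 0 ∉ S₀ the hypothesis is witnessed by S₀ = {0} (no good place), so the typed D′ is all-parity icosahedral strong Artin over ℚ ≡ GaloisWeightedBE.StrongArtinIcosahedralQ (stmt-10841), kernel-checked p116764 — summit-sector strength, not theorem-sized.
sources: LanglandsBaseChange1980, ArthurClozelAMS120 Ch. 3, LabesseLanglands1979, Ramakrishnan1994, Tunnell1981, Gelbart1997
[crux] (D′, rev 8; theorem-sized UNIFORM descent ℚ ← K; crux by the crux-only rule) ρ irreducible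
icosahedral over ℚ, ι : ℚ̄₂ ≃ ℂ. Suppose ONE finite set of rational primes S₀ serves every imaginary
quadratic K with 2 split: there are a 2-adic model σ of ρ|_K (entrywise through ι) and a cuspidal
π_K of GL₂(𝔸_K) with SatakeFrobCompatibleAt ι π_K σ w at every place w of K over no prime of S₀ (m =
1, arithmetic: α(π_K,w) = eigenvalues of ρ^∨(Frob_w)). Then some cuspidal π of GL₂(𝔸_ℚ) has
satakePolynomial α(π,v) = charpoly ρ(Frob_v) a.e. Proof: π_{K₁} ≅ π_{K₁}^c (SMO) descends to π′ up
to χ_{K₁} (LanglandsBaseChange1980; ArthurClozelAMS120 Ch. 3); the descent from K₂ compared inside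
K₁K₂ (BC cuspidal: A₅ has no dihedral quotient; π ≇ π ⊗ χ, LabesseLanglands1979) fixes ONE π with
BC_K(π) ≅ π_K for K₁, K₂ and then for every 2-split K (χ_K ∉ ⟨χ_{K₁}, χ_{K₂}⟩); for each prime p ∉
S₀ pick K with p split: the split place w ∣ p is good, so π_p is unramified and matches ρ^∨(Frob_p)
EXACTLY; hence π matches ρ^∨ at every p ∉ S₀ and its contragredient matches ρ (tree
exists_contragredient_satake). Supersedes IcosahedralQuadraticDescent (stmt-Langlands-13461), whose
a.e.-per-K hypothesis made it u -/
@[route_item "route-Langlands-ParityBlindBianchi", crux]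
def IcosahedralDescentLevel : Prop :=
  ∀ (ι : PadicAlgCl 2 ≃+* ℂ) (ρ : Literature.NumberTheory.GaloisRepresentations.FramedGaloisRep ℚ ℂ 2), ρ.toGaloisRep.IsIrreducible → Nonempty ((Matrix.ProjGenLinGroup.mk.comp ρ.toMonoidHom).range ≃* alternatingGroup (Fin 5)) → (∃ S₀ : Finset ℕ, ∀ (K : Type) [Field K] [NumberField K], NumberField.IsTotallyComplex K → Module.finrank ℚ K = 2 → (∃ v w : IsDedekindDomain.HeightOneSpectrum (NumberField.RingOfIntegers K), v ≠ w ∧ ((2 : ℕ) : NumberField.RingOfIntegers K) ∈ v.asIdeal ∧ ((2 : ℕ) : NumberField.RingOfIntegers K) ∈ w.asIdeal) → ∃ (σ : Literature.NumberTheory.GaloisRepresentations.FramedGaloisRep K (PadicAlgCl 2) 2) (hcpt : Literature.NumberTheory.Automorphic.isCompact_glFiniteIntegralLevel 2 K) (π : Literature.NumberTheory.Automorphic.CuspidalAutomorphicRepData 2 K hcpt), (∀ (g : Field.absoluteGaloisGroup K) (i j : Fin 2), ι ((σ g).val i j) = ((Literature.NumberTheory.GaloisRepresentations.FramedGaloisRep.restrictField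 K ρ) g).val i j) ∧ ∀ w : IsDedekindDomain.HeightOneSpectrum (NumberField.RingOfIntegers K), (∀ ℓ ∈ S₀, ((ℓ : ℕ) : NumberField.RingOfIntegers K) ∉ w.asIdeal) → Summit.Langlands.SatakeFrobCompatibleAt ι π.1 σ w) → ∃ (hcpt : Literature.NumberTheory.Automorphic.isCompact_glFiniteIntegralLevel 2 ℚ) (π : Literature.NumberTheory.Automorphic.CuspidalAutomorphicRepData 2 ℚ hcpt), (∀ᶠ v : IsDedekindDomain.HeightOneSpectrum (NumberField.RingOfIntegers ℚ) in Filter.cofinite, ∃ α : Multiset ℂ, π.1.HasSatakeParamAt v α ∧ ρ.IsUnramifiedAt v ∧ ρ.HasFrobCharpolyAt v (Literature.NumberTheory.Automorphic.satakePolynomial α))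

/-- item stmt-Langlands-16620 · support · rank 5 · open · by planner
why it might fail: Provable ONLY because S₀ is uniform in K and 0 ∉ S₀; fails as typed if the m = 1 arithmetic SatakeFrobCompatibleAt ↔ contragredient satakePolynomial dictionary is mis-transcribed, or if a vendored base-change fact is itself mis-stated.
sources: LanglandsBaseChange1980, ArthurClozelAMS120 Ch. 3 Thm 3.1, 4.2(a),(d), 5.1, LabesseLanglands1979, Ramakrishnan1994, Tunnell1981, Gelbart1997
[crux] (D′R, rev 10 repair of D′ IcosahedralDescentLevel stmt-Langlands-15113 — MISSTATED: S₀ = {0}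
leaves no good place, so the typed D′ was all-parity icosahedral strong Artin ≡
GaloisWeightedBE.StrongArtinIcosahedralQ stmt-10841, kernel-checked p116764; repair = insert `(0 :
ℕ) ∉ S₀`; theorem-sized UNIFORM descent ℚ ← K; crux by the crux-only rule) ρ irreducible icosahedral
over ℚ, ι : ℚ̄₂ ≃ ℂ. Suppose ONE finite set S₀ of naturals with 0 ∉ S₀ serves every imaginary
quadratic K with 2 split: there are a 2-adic model σ of ρ|_K (entrywise through ι) and a cuspidal
π_K of GL₂(𝔸_K) with SatakeFrobCompatibleAt ι π_K σ w at every place w of K over no element of S₀ (m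
= 1, arithmetic: α(π_K,w) = eigenvalues of ρ^∨(Frob_w)). Then some cuspidal π of GL₂(𝔸_ℚ) has
satakePolynomial α(π,v) = charpoly ρ(Frob_v) a.e. PROVED modulo the tree's four Arthur–Clozel named
facts F1 cuspidal_descent_cyclic, F2 ArthurClozel1989_strongLifting_unramified, F3
baseChange_cyclic_cuspidal, F4 ArthurClozel_fibres_quadratic:
Theorems/ParityBlindBianchiIcosahedralDescentLevelMain.lean (p111861)
`icosahedralDescentLevel_repaired` (F1–F4 as hypotheses; this statement's hypothesis/conclusion
verbatim) and `icosahe -/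
@[route_item "route-Langlands-ParityBlindBianchi"]
def IcosahedralDescentLevelR : Prop :=
  ∀ (ι : PadicAlgCl 2 ≃+* ℂ) (ρ : Literature.NumberTheory.GaloisRepresentations.FramedGaloisRep ℚ ℂ 2), ρ.toGaloisRep.IsIrreducible → Nonempty ((Matrix.ProjGenLinGroup.mk.comp ρ.toMonoidHom).range ≃* alternatingGroup (Fin 5)) → (∃ S₀ : Finset ℕ, (0 : ℕ) ∉ S₀ ∧ ∀ (K : Type) [Field K] [NumberField K], NumberField.IsTotallyComplex K → Module.finrank ℚ K = 2 → (∃ v w : IsDedekindDomain.HeightOneSpectrum (NumberField.RingOfIntegers K), v ≠ w ∧ ((2 : ℕ) : NumberField.RingOfIntegers K) ∈ v.asIdeal ∧ ((2 : ℕ) : NumberField.RingOfIntegers K) ∈ w.asIdeal) → ∃ (σ : Literature.NumberTheory.GaloisRepresentations.FramedGaloisRep K (PadicAlgCl 2) 2) (hcpt : Literature.NumberTheory.Automorphic.isCompact_glFiniteIntegralLevel 2 K) (π : Literature.NumberTheory.Automorphic.CuspidalAutomorphicRepData 2 K hcpt), (∀ (g : Field.absoluteGaloisGroup K) (i j : Fin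 2), ι ((σ g).val i j) = ((Literature.NumberTheory.GaloisRepresentations.FramedGaloisRep.restrictField K ρ) g).val i j) ∧ ∀ w : IsDedekindDomain.HeightOneSpectrum (NumberField.RingOfIntegers K), (∀ ℓ ∈ S₀, ((ℓ : ℕ) : NumberField.RingOfIntegers K) ∉ w.asIdeal) → Summit.Langlands.SatakeFrobCompatibleAt ι π.1 σ w) → ∃ (hcpt : Literature.NumberTheory.Automorphic.isCompact_glFiniteIntegralLevel 2 ℚ) (π : Literature.NumberTheory.Automorphic.CuspidalAutomorphicRepData 2 ℚ hcpt), (∀ᶠ v : IsDedekindDomain.HeightOneSpectrum (NumberField.RingOfIntegers ℚ) in Filter.cofinite, ∃ α : Multiset ℂ, π.1.HasSatakeParamAt v α ∧ ρ.IsUnramifiedAt v ∧ ρ.HasFrobCharpolyAt v (Literature.NumberTheory.Automorphic.satakePolynomial α))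

-- earlier Assembly (stmt-Langlands-13462, replaced 2026-08-16T07:53:07Z -> stmt-Langlands-15109): proved by Summit.Langlands.Langlands.Theorems.ParityBlindBianchi.Assembly_proof @ be42cdc25e20 — ResidualBianchiDoorMod2 → TwoAdicBianchiProModularity → ArtinWeightRealisation → IcosahedralQuadraticDescent → EvenArtinJunction → _root_.Langlands
-- earlier Assembly (stmt-Langlands-15109, replaced 2026-08-17T04:12:21Z -> stmt-Langlands-17683): proved by Summit.Langlands.Langlands.Theorems.ParityBlindBianchi.Assembly_rev8_proof @ e3f3bb6dd761 — ResidualBianchiDoorLevel → TwoAdicBianchiProModularityLevel → ArtinWeightRealisationLevel → IcosahedralDescentLevel → EvenArtinJunction → _root_.Langlands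
/-- item stmt-Langlands-17683 · assembly · rank 1 · closed · proved by Summit.Langlands.Langlands.Theorems.ParityBlindBianchi.Assembly_rev8_proof (prover) · by planner
sources: BuzzardGeeLMS2014, KhareWintenberger2009
[assembly] QuadraticDescentGL2 → QuadraticBaseChangeGL2 → ResidualBianchiDoorLevelBC →
TwoAdicBianchiProModularityLevel → ArtinWeightRealisationEven → IcosahedralDescentLevelBC →
EvenArtinJunction → Langlands (documentary, rev 17; the deciding theorem `closes` has exactly this
type — same binder order — and proves it; the landed Theorems/ParityBlindBianchiAssemblyRev8.lean
`Assembly_rev8_proof : Assembly := by unfold Assembly; exact closes` proves it verbatim). -/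
@[route_item "route-Langlands-ParityBlindBianchi"]
def Assembly : Prop :=
  QuadraticDescentGL2 → QuadraticBaseChangeGL2 → ResidualBianchiDoorLevelBC → TwoAdicBianchiProModularityLevel → ArtinWeightRealisationEven → IcosahedralDescentLevelBC → EvenArtinJunction → _root_.Langlands

-- records of items no longer active in this route (dropped / restated):
-- earlier EvenIcosahedralFromBianchi (stmt-Langlands-14458, dropped 2026-08-16T07:53:07Z): proved by Summit.Langlands.Langlands.Theorems.EvenIcosahedralFromBianchi_proof @ e83791f17f74 — ResidualBianchiDoorMod2 → TwoAdicBianchiProModularity → ArtinWeightRealisation → IcosahedralQuadraticDescent → EvenIcosahedralStrongArtin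

/-! D-0027 §2.1 — DECIDING THEOREM (planner-authored via `route open/edit --closes-file`; by planner-rchoice-Langlands-ParityBlindBianchi-A-303d852a-0 2026-08-17T04:12:21Z):
its hypotheses are this route's items and its conclusion the sub-problem Statement (glue_lint), and it elaborates with this file. -/

/-- DECIDING THEOREM (D-0027 §2.1), crux-only; route-choice on the negative-lemma hold of R′
`ArtinWeightRealisationLevel` (stmt-Langlands-15111, zero sector `0 ∈ S₀` forces the bare existence
of Bianchi cusp forms: `Theorems/ArtinWeightRealisationLevel/Negative/ZeroSector.lean`). The seven
hypotheses are the route's seven load-bearing cruxes: the promoted quadratic descent / base change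
for `GL₂` (`QuadraticDescentGL2`, `QuadraticBaseChangeGL2`; theorems in print, XL-apex facts ruled
non-citable), the base-change-conditional residual door E1″ `ResidualBianchiDoorLevelBC` (uniform
bad set `S₀` with `2 ∈ S₀`, `0 ∉ S₀` and, for every 2-split imaginary quadratic `K`, the 2-adic model
`σ` of `ρ|_K` with a regular algebraic cuspidal `π₀` congruent to it at every place off `S₀`), E2′
`TwoAdicBianchiProModularityLevel` (⇒ a continuous `ℤ̄₂`-point of `Spf 𝕋(U^2)` Hansen-associated
with `σ` off `S₀`), R″ `ArtinWeightRealisationEven` at `p = 2` (the EVEN sector the route consumes,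
`0 ∉ S₀`: ⇒ a cuspidal `π_K` Satake–Frobenius compatible with `σ` at EVERY place off `S₀`), D″
`IcosahedralDescentLevelBC` (uniform descent `ℚ ← K` ⇒ the target `EvenIcosahedralStrongArtin` for
`ρ`), and the junction `EvenArtinJunction` (target ⇒ summit). Pure logic plus an abstract field
isomorphism `ι : ℚ̄₂ ≃+* ℂ` (Steinitz: both fields are algebraically closed of characteristic `0`
and cardinality `𝔠`; proved inline from Mathlib's `IsAlgClosed.ringEquiv_of_equiv_of_charZero`).
The evenness hypothesis of the target IS consumed now (R″ is stated on the even sector). -/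
@[closes "route-Langlands-ParityBlindBianchi"] theorem closes (hQD : QuadraticDescentGL2) (hQBC : QuadraticBaseChangeGL2)
    (hE1 : ResidualBianchiDoorLevelBC) (hE2 : TwoAdicBianchiProModularityLevel)
    (hR : ArtinWeightRealisationEven) (hD : IcosahedralDescentLevelBC)
    (hJ : EvenArtinJunction) : _root_.Langlands := by
  -- the chain derives the TARGET by name; the junction carries it to the summit statement
  suffices hT : EvenIcosahedralStrongArtin from hJ hT
  intro ρ hirr hA5 heven
  -- an abstract field isomorphism ℚ̄₂ ≃+* ℂ (Steinitz)
  have hQ2 : Cardinal.mk ℚ_[2] = Cardinal.continuum := by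
    apply le_antisymm
    · change Cardinal.mk (Quotient (CauSeq.equiv : Setoid (CauSeq ℚ (padicNorm 2)))) ≤ Cardinal.continuum
      refine (Cardinal.mk_quotient_le (s := (CauSeq.equiv : Setoid (CauSeq ℚ (padicNorm 2))))).trans ?_
      refine (Cardinal.mk_subtype_le _).trans_eq ?_
      rw [← Cardinal.power_def, Cardinal.mk_nat, Cardinal.mkRat, Cardinal.aleph0_power_aleph0]
    · exact continuum_le_cardinal_of_nontriviallyNormedField ℚ_[2]
  have hC2 : Cardinal.mk (PadicAlgCl 2) = Cardinal.continuum := by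
    apply le_antisymm
    · refine (Algebra.IsAlgebraic.cardinalMk_le_max ℚ_[2] (PadicAlgCl 2)).trans ?_
      rw [hQ2, max_eq_left Cardinal.aleph0_le_continuum]
    · rw [← hQ2]
      exact Cardinal.mk_le_of_injective (algebraMap ℚ_[2] (PadicAlgCl 2)).injective
  obtain ⟨ι⟩ : Nonempty (PadicAlgCl 2 ≃+* ℂ) := by
    refine IsAlgClosed.ringEquiv_of_equiv_of_charZero ?_
      (Cardinal.eq.1 (by rw [hC2, Cardinal.mk_complex]))
    rw [hC2]
    exact Cardinal.aleph0_lt_continuum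
  -- E1″ (fed with quadratic base change): the uniform bad set S₀ with 2 ∈ S₀, 0 ∉ S₀ and, per
  -- 2-split imaginary quadratic K, the residually automorphic 2-adic model σ of ρ|_K
  obtain ⟨S₀, h2, h0, hK⟩ := hE1 hQBC ι ρ hirr hA5
  -- D″ (fed with quadratic descent and base change) reduces the target to uniform (off S₀)
  -- compatibility over every 2-split imaginary quadratic K
  refine hD hQD hQBC ι ρ hirr hA5 ⟨S₀, h0, ?_⟩
  intro K _ _ htc hdeg hsplit
  obtain ⟨σ, hmodel, hfin, hirrσ, hA5σ, hcpt, π₀, hRA, hgood⟩ := hK K htc hdeg hsplit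
  -- E2′ (2-adic pro-modularity at tame level S₀) feeds R″ (realisation at p = 2 on the even
  -- sector: σ is the ι-model of ρ|_K with ρ even icosahedral; 0 ∉ S₀ excludes the zero sector)
  obtain ⟨hcpt', π, hπ⟩ := hR 2 ι ρ hirr hA5 heven K htc hdeg σ hmodel hfin hirrσ S₀ h2 h0
    (hE2 K htc hdeg hsplit ι σ hfin hirrσ hA5σ S₀ h2 ⟨hcpt, π₀, hRA, hgood⟩)
  exact ⟨σ, hcpt', π, hmodel, hπ⟩

end Summit.Langlands.Langlands.Theses.ParityBlindBianchi
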